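import Literature.MathematicalPhysics.QuantumFieldTheory.Balaban1983to89.T4BlockTransport

/-!
# `Balaban1983to89.T4RelativeCombCrossing` — TWO neighbouring blocks of `ℤ^d` in relative axial gauge, NON-ABELIAN:
# the crossing-bond chain of the proof of Lemma 1 of B8 (CMP 99, pp. 79–80) on concrete carriers

CITATION HEADER (lean-in-tree rule 2026-08-18).  Kernel certificate, on CONCRETE `ℤ^d` carriers and for NON-COMMUTING
unit-valued bond variables, of the elementary lattice-geometric / group-theoretic content of the CROSSING-BOND sentences
of the proof of Lemma 1 of T. Bałaban, *Spaces of regular gauge field configurations on a lattice and gauge fixing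
conditions*, Comm. Math. Phys. **99**, 75–102 (1985) [Balaban1985RegularSpaces] (cell paper B8 of the audit cell
`pub-balaban`), pp. 79–80, with the block / tree / contour conventions of [3] = T. Bałaban, *Averaging operations for
lattice gauge theories*, Comm. Math. Phys. **98**, 17–51 (1985) [Balaban1985Averaging] (cell paper B7), pp. 19, 23–25.
The quotations below are COPIED from the already certified citation header of the tree module `B8Lemma1Lattice` (b08
lineage, census C-B8-33; renders named there) and of `T4RelativeComb` (pv04 lineage, C-pv04g13-1); no new reading of a
render is claimed.  They are CONTEXT for an ELEMENTARY, undisputed step.  The papers are manuscripts UNDER ADJUDICATION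
by the cell; nothing of them is asserted here: the file DEFINES a concrete model (unit-valued bond variables on `ℤ^d`,
two corner-anchored blocks, the crossing bonds between them) and PROVES [folklore] facts about it; no printed claim
enters as a hypothesis.

PRINTED ([Balaban1985RegularSpaces] p. 79, proof of Lemma 1, after the interior-bond sentence "|V′_b − 1| <
(d−1)(L−1)2α₀L⁻² for b ⊂ B(y)"): "For a plaquette p connecting two neighboring blocks B(c₋), B(c₊) we take two bonds
b′, b″ ⊂ ∂p, b′, b″ ∈ B(c) and from (1.26) and the bounds on |V′_b − 1| for b′, b″ belonging either to B(c₋), or to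
B(c₊), we get |R(V₀(b′₋, b″₋))V′_{b″} − V′_{b′}| < 2α₀L⁻² + 4(d−1)α₀L⁻¹ < 4dα₀L⁻¹. Thus |R(V₀(Γ_{b₀,₋,b₋}))V′_b −
V′_{b₀}| < (d−1)(L−1)4dα₀L⁻¹ < 4(d−1)dα₀ for an arbitrary bond b ∈ B(c) and b₀ being the unique bond of c belonging to
B(c). The condition |\overline{V′V₀} − V̄₀| = |Ṽ′ − 1| < α₁ implies |R(V₀([c₋, b₀,₋]))V′_{b₀} − 1| ≦ 4(d−1)" (p. 80)
"(L−1)Lα₀L⁻² + α₁ < 4(d−1)α₀ + α₁, hence finally we have the bound (1.25) for an arbitrary bond b.  From this proof it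
follows that the result is local in the sense that the bound (1.25) for a bond b depends on bounds (1.7), (1.24) on
B(c₋)∪B(c₊), if b belongs to this set."  PRINTED (ibid. p. 79): "B^j(c) = {b ⊂ T : b₋ ∈ B^j(c₋), b₊ ∈ B^j(c₊)}. (1.23)";
"(∂_{U₀}U′)(p) = U′(x,y)R(U₀(x,y))U′(y,z)R(U₀(x,w))U′(z,w)U′(w,x). (1.22)"; "|(∂_{V₀}V′)(p) − 1| ≦ |V₀(∂p) − 1| +
|(V′V₀)(∂p) − 1| < 2α₀L⁻². (1.26)".  PRINTED ([3] p. 19): "Γ_{c,x} = Γ_{c₋,x} ∪ [x, x(c)] ∪ Γ_{x(c),c₊}", `x(c) = x + Le_μ`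
for `c = ⟨c₋, c₋ + Le_μ⟩`, `x ∈ B(c₋)`; ([3] p. 23) "Ū_c = exp[i Σ_{x∈B(c₋)} L^{−d} (1/i) log U(Γ_{c,x})U(c)⁻¹] U(c) (42)".

READING — THE MODEL (the cell's, not the papers' words; the conventions of `T4RelativeComb` / `B8Lemma1Lattice`).  Bond
variables are units `U x ν ∈ Rˣ` of a normed ring on the bonds `⟨x, x + e_ν⟩` of `ℤ^d` (`T4RelativeComb.Cfg`), "G-valued" =
`T4RelativeLadder.UnitaryLike` (`‖u‖ ≤ 1 ∧ ‖u⁻¹‖ ≤ 1`: conjugation is an isometry on `· − 1`), based plaquette words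
`T4RelativeComb.plaq`, ordered tree holonomies `T4RelativeComb.hol` along the `d`-first staircase trees `Γ_{z,x}` of [3]
p. 24.  The pair `(V₀, V′V₀)` of Lemma 1 is a pair `(U₀, V)` of configurations; `V′ = (V′V₀)·V₀⁻¹` bond-wise is
`pert U₀ V x ν = V⟨x,x+e_ν⟩·U₀⟨x,x+e_ν⟩⁻¹`; the first half of (1.24), "(R(V₀)V′)(Γ_{y,x}) = 1 for x ∈ B(y)" ⟹ "V′_b = 1
for b ⊂ Γ_{y,x}", is taken in the bond-wise form `TreeRel L z U₀ V` (`V = U₀` on every tree bond with both ends in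
`B(z)`; the comb gauge of `T4RelativeComb` PRODUCES such data, `treeRel_comb`).  The two neighbouring blocks of a
positively oriented coarse bond `c = ⟨y, y + Le_μ⟩` are `B(c₋) = B(y)`, `B(c₊) = B(y + Le_μ)` (`B8Lemma1Lattice.yplus`,
`InPair`), the `L^{d−1}` crossing bonds `B(c)` of (1.23) are `⟨x_t, x_t + e_μ⟩`, `x_t = y + t + (L−1)e_μ` for a
transverse position `t` (`B8Lemma1Lattice.Trans`, `offset`; `crossSite`), `b₀ = ⟨y + (L−1)e_μ, y + Le_μ⟩` is the one on
the line of `c` (`crossSite` of `tzero`), "R(V₀(b′₋, b″₋))V′_{b″}" is the conjugate `U₀⟨x_t, x_t+e_ν⟩·V′(b″)·U₀⟨x_t,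
x_t+e_ν⟩⁻¹` (transport of `V′(b″)` back to `b′₋` along the bond joining the two starting points), and the straight
corner contour `Γ_{c,c₋} = [y, y + Le_μ]` ("U(c)" of (42)) has holonomy `hol U y (Pi.single μ L)` (its first `L − 1`
bonds are tree bonds of `B(y)`, the last one is `b₀`).

WHAT THE TREE ALREADY HAS.  `T4RelativeComb` (pv04-g13): the one-block relative comb gauge — `combGauge`, tree bonds
fixed (`gaugeAct_combGauge_tree`), the ladder count `norm_defect_sub_one_le_ladderLen`, `interior_bound_crude :
‖(U₁^g)U₀⁻¹ − 1‖ ≤ (d−1)(L−1)(q₁ + q₀)` on interior bonds, `axial_bound`; HONEST SCOPE (i): "no patching of the comb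
gauges of neighbouring blocks … the crossing-bond and average part … is NOT treated".  `T4BlockTransport` (t4-ne1p-p1-g2):
holonomy covariance `hol_gaugeAct`, the loop holonomy `loopHol`.  `B8Lemma1Lattice` (b08-g12): the two-block geometry
(`yplus`, `InPair`, `Trans`, `offset`, `offset_step`, `site_offset_add`, `StepAdj`, `dist1`, `reach_of_dist1`,
`dist1_le : dist1 ≤ (d−1)(L−1)`, `not_right_left`) and the whole of Lemma 1 in the ABELIAN (additive) model
(`crossVal_step`, `lemma1_lattice`), HONEST SCOPE (i): "ABELIAN MODEL ONLY: the R(·)-transports in (1.22)/(1.26) and in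
the crossing-bond chain … are NOT formalised".  `B8Lemma1Abelian` (adv1-g9): `Reach` and the coefficient analysis
(`coeff_lt_printed`, `printedChain_gt`, census G-B8-10 — not re-litigated here).

WHAT THIS FILE ADDS (kernel-checked; new sibling leaf, imports `T4BlockTransport` BY NAME, nothing above is edited;
every theorem [folklore]).
§1 Algebra near `1`: two-sided unitary-like multiplication contracts differences (`norm_conj_sub_conj_le`,
   `norm_sub_conj_le_symm`) and THE WORD OF ONE MIXED PLAQUETTE: `‖P⁻¹·W₁·(aW₂a⁻¹)·P₀·(cW₃⁻¹c⁻¹) − aW₂a⁻¹‖ ≤ ‖P − 1‖ +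
   ‖W₁ − 1‖ + ‖P₀ − 1‖ + ‖W₃ − 1‖` (`norm_step_word_sub_le`).
§2 `pert`, `TreeRel`; under `TreeRel` the holonomies of `V` and `U₀` along block trees agree (`hol_congr_of_treeRel`),
   the relative comb gauge of `(U₀, V)` is `1` on the block (`combGauge_eq_one_of_treeRel`), so `T4RelativeComb.defect
   U₀ V z = pert U₀ V` on interior bonds (`defect_eq_pert_of_treeRel`) and the one-block interior bound holds for GIVEN
   gauge-fixed data: `‖pert − 1‖ ≤ (d−1)(L−1)(q_V + q₀)` (`interior_bound_of_treeRel`, `T4RelativeComb.interior_bound_crude`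
   BY NAME); conversely the comb gauge produces `TreeRel` data (`treeRel_comb`).
§3 The crossing bonds (`crossSite`, `crossSite_step`, `crossSite_add_e`) and THE STEP: the EXACT group identity behind
   "|R(V₀(b′₋, b″₋))V′_{b″} − V′_{b′}| < 2α₀L⁻² + 4(d−1)α₀L⁻¹" — `V′(b′) = (V′V₀)(∂p)⁻¹ · V′⟨x,x+e_ν⟩ · R(V₀(b′₋,b″₋))V′(b″)
   · V₀(∂p) · Ad_{V₀(b′)}(V′⟨x+e_μ,·⟩⁻¹)` for the mixed plaquette `p = (x_t; ν, μ)` (`pert_cross_identity`, by `group`),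
   hence `‖V′(b′) − R(·)V′(b″)‖ ≤ q_V + q₀ + I₋ + I₊` (`norm_pert_cross_sub_transport_le`; on the lattice with the
   block-membership bookkeeping `cross_step`, both orientations `cross_step_adj`) — `q_V, q₀` the two curvature sups on the
   plaquettes of `B(c₋) ∪ B(c₊)` (`PlaqSupPair`; the two terms of (1.26)), `I₋, I₊` the interior defect bounds of the two
   blocks (the printed `2·(d−1)(L−1)2α₀L⁻² < 4(d−1)α₀L⁻¹`).
§4 THE CHAIN "for an arbitrary bond b ∈ B(c)": along `B8Lemma1Abelian.Reach StepAdj n` the transports COMPOSE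
   (`cross_chain`: `∃ P` unitary-like, `‖V′(b) − P·V′(b′)·P⁻¹‖ ≤ n·s`), so by `reach_of_dist1` / `dist1_le` BY NAME any two
   crossing bonds satisfy `‖V′(b) − P·V′(b′)·P⁻¹‖ ≤ (d−1)(L−1)·s` (`cross_any`) and `‖V′(b) − 1‖ ≤ ‖V′(b′) − 1‖ +
   (d−1)(L−1)·s` (`norm_cross_sub_one_le`) — the printed "(d−1)(L−1)·4dα₀L⁻¹" shape with `s = q_V + q₀ + I₋ + I₊`.
§5 THE CORNER CONTOUR: `tzero`, `b₀ = crossSite tzero = ⟨y + (L−1)e_μ, ·⟩` (`crossSite_tzero`), and the EXACT identity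
   `V(c)·U₀(c)⁻¹ = R(V₀([c₋, b₀,₋]))V′(b₀)` — `hol V y (Le_μ)·(hol U₀ y (Le_μ))⁻¹ = P₀·pert(b₀)·P₀⁻¹`, `P₀ = hol U₀ y
   ((L−1)e_μ)` (`corner_contour`; the `L − 1` tree bonds of the line carry `V = U₀`), so `‖V(c)U₀(c)⁻¹ − 1‖ = ‖V′(b₀) − 1‖`
   (`norm_corner_contour_sub_one`): on `B(c₋) ∪ B(c₊)` the pair is controlled by its curvatures and ONE number per coarse
   bond, `X_c := ‖V(c)U₀(c)⁻¹ − 1‖`.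
§6 ASSEMBLY (`two_block_bound`): for unitary-like `(U₀, V)` in relative axial gauge on both blocks with curvature sups
   `q_V, q₀` on the plaquettes of `B(c₋) ∪ B(c₊)`, EVERY bond with both ends in `B(c₋) ∪ B(c₊)` has `‖V′ − 1‖ ≤
   (d−1)(L−1)(1 + 2(d−1)(L−1))·(q_V + q₀) + X_c` (interior bonds by §2, crossing bonds — recognised by `crossing_of_inPair`
   — by §4 + §5 with `I₋ = I₊ = (d−1)(L−1)(q_V + q₀)`); and the COMB form `two_block_bound_comb`: for an ARBITRARY
   unitary-like `U₁` the block-wise patched comb gauge `patchGauge` (comb gauge of `B(c₋)` on `B(c₋)`, of `B(c₊)`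
   elsewhere) puts `(U₀, U₁^g)` in relative axial gauge on both blocks (`treeRel_patch_left/right`), so the same bound
   holds for `V = U₁^g` — record (O2b) "block-wise combs, patched" for two blocks, in sup norm.
§7 THE CONTOURS `Γ_{c,x} = Γ_{y,x} ∪ [x, x + Le_μ] ∪ Γ_{x(c), c₊}` of the average (42) (`contourHol`; `contourHol_zero`:
   the corner's contour is the coarse bond, "U(c)"): the segment RATIO `V([x, x+ne_μ])U₀([x, x+ne_μ])⁻¹` (`segRatio`) is the
   ordered product of the TRANSPORTED `V′` of the segment (`segRatio_succ`), hence the plain chain `‖segRatio n − 1‖ ≤ n·I`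
   (`norm_segRatio_sub_one_le`) and the chain WITH ONE FREE FACTOR `‖segRatio − Ad(V′(free bond))‖ ≤ (others)·I`
   (`norm_segRatio_sub_conj_le`); in relative axial gauge on both blocks the two tree legs cancel up to conjugation
   (`contour_ratio_eq`), the segment of `x = y + t + h₀e_μ` consists of `L−1−h₀` interior bonds of `B(c₋)`, the crossing bond
   `b_t` and `h₀` interior bonds of `B(c₊)`, so EVERY CONTOUR RATIO IS A CONJUGATE OF ITS CROSSING BOND up to `(L−1)·I`
   (`contour_ratio_conj`) and — by §4 + §5 — A CONJUGATE OF THE COARSE-BOND RATIO `w_c = V(c)U₀(c)⁻¹` up to `ρ = (L−1)I +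
   (d−1)(L−1)(q_V + q₀ + 2I)` (`contour_ratio_near_coarse`; assembled with `I = (d−1)(L−1)(q_V + q₀)`: `contour_ratios`, `ρ =
   (d−1)(L−1)(L + 2(d−1)(L−1))·(q_V + q₀)`, `contourConst`) — the printed "4(d−1)(L−1)Lα₀L⁻²" accounting, non-abelian, and the
   exact shape of the input to the (untyped) average sentence.
§8 Non-vacuity (flat pair: all hypotheses inhabited with `q_V = q₀ = 0`, and then `X_c = 0` and `V′ = 1` is forced).

HONEST SCOPE / NOT TYPED.  (i) THE AVERAGE SENTENCE IS NOT TYPED: the last printed step "|Ṽ′ − 1| < α₁ implies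
|R(V₀([c₋, b₀,₋]))V′_{b₀} − 1| ≦ 4(d−1)(L−1)Lα₀L⁻² + α₁" — i.e. the MEAN INVERSION "a bound `α₁` between the (42)-averages
of `V` and of `U₀`, whose `L^d` contour inputs have ratios each `ρ`-close to a conjugate of the one element `w_c` (§7),
forces `‖w_c − 1‖ ≤ α₁ + O(ρ)`" — goes through the NON-LINEAR block average (42) of [3] (`exp∘mean∘log` on the group, its
equivariance and Lipschitz properties, the `U₀`-holonomies in a suitable gauge: BCH territory of the B7/B8 sub-cells) and is
left as the single located residual of this leaf: every statement here carries `X_c = ‖w_c − 1‖ = ‖V′(b₀) − 1‖`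
(`norm_corner_contour_sub_one`) explicitly; in the abelian model the step is the hypothesis `hmean` of
`B8Lemma1Abelian.lemma1_abelian`, where the mean of `ρ`-close numbers is `ρ`-close.  Consequently `B8.Lemma1Printed` is NOT
claimed for a non-abelian family, and the printed constant `4d²` (the abelian mean-based count, G-B8-10) is not compared
with.  (ii) TWO BLOCKS, SUP
NORM, positively oriented coarse bond (`B(c₊) = B(c₋) + Le_μ`; the other orientation is the same configuration read from
the other block); no Hölder norms, no `M`-cube of blocks (pairwise application is immediate but not spelled out), no
curvature of a moved background.  (iii) "G-valued" = `UnitaryLike` for BOTH configurations (for a non-unitary pair every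
conjugation costs `‖u‖‖u⁻¹‖`, cf. `T4AxialChain.norm_conj_sub_one_le`; not covered).  (iv) The curvature hypotheses are
asked only on plaquettes with all four corners in `B(c₋) ∪ B(c₊)` (weaker than (1.7) on `Ω₁`), crude form `q_V + q₀` only
(the fine form with the commutator cross term of `T4RelativeComb.interior_bound_fine` is not threaded through the chain).
(v) The transports `P` of §4 are produced existentially (a product of `U₀`-bond variables along the chain of
`reach_of_dist1`), which is all the `‖· − 1‖` bounds need; the printed `Γ_{b₀,₋,b₋}` is not singled out.  (vi) NO statement
about Bałaban's renormalization transformations, averages, windows or regularity spaces is asserted; value = kernel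
bookkeeping of finite group identities and triangle inequalities on concrete carriers + a located-gap narrowing
(`T4RelativeComb` (i) / `B8Lemma1Lattice` (i) ⟶ "the average inversion only"), NOT summit progress.  Unit
`b2b-balaban-pv04` gen 14 (journal claim T4-O3.E-NE1′-OG1′-CROSS*).
-/

namespace Literature.MathematicalPhysics.QuantumFieldTheory.Balaban1983to89.T4RelativeCombCrossing

open Finset
open B8Lemma1Lattice (e site site_add_single site_site InBlock inBlock_site_iff exists_offset_of_inBlock lt_of_add_single yplus
  InPair Trans offset offset_apply_mu offset_apply_ne offset_apply_sub offset_lt offset_add_single site_offset_add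
  offset_step StepAdj dist1 reach_of_dist1 dist1_le not_right_left)
open B8Lemma1Abelian (Reach)
open T4RelativeLadder (UnitaryLike norm_conj_sub_one_eq norm_unit_mul_le norm_mul_unit_le norm_inv_sub_one_le)
open T4RelativeComb (Cfg gaugeAct plaq plaq_gaugeAct unitaryLike_gaugeAct unitaryLike_plaq IsTree low pred' pred'_le
  pred'_add_single isTree_pred' sum_eq_sum_pred'_succ hol hol_zero hol_succ unitaryLike_hol relGauge combGauge
  combGauge_site unitaryLike_combGauge gaugeAct_combGauge_tree defect PlaqSup interior_bound_crude)

variable {R : Type*} [NormedRing R] {d : ℕ}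

/-- [folklore] Sites of `ℤ^d` — the SAME carrier as `B8Lemma1Lattice.Site d` / `T4RelativeComb.Site d` (definitionally;
re-declared here only so that the bare name is not captured by an unrelated `Site` of an ancestor namespace). -/
abbrev Site (d : ℕ) : Type := Fin d → ℤ

example (d : ℕ) : Site d = T4RelativeComb.Site d := rfl

/-! ## §1  Algebra near `1`: transported comparisons in a normed ring -/

/-- [folklore] Conjugation by a unitary-like unit contracts differences: `‖a·x·a⁻¹ − a·y·a⁻¹‖ ≤ ‖x − y‖`. -/
theorem norm_conj_sub_conj_le {a : Rˣ} (ha : UnitaryLike a) (x y : R) :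
    ‖(a : R) * x * ↑a⁻¹ - (a : R) * y * ↑a⁻¹‖ ≤ ‖x - y‖ := by
  have e1 : (a : R) * x * ↑a⁻¹ - (a : R) * y * ↑a⁻¹ = (a : R) * (x - y) * ↑a⁻¹ := by noncomm_ring
  rw [e1]
  exact (norm_mul_unit_le ha.inv _).trans (norm_unit_mul_le ha _)

/-- [folklore] Moving a transport to the other side: `‖x − a⁻¹·y·a‖ ≤ ‖y − a·x·a⁻¹‖` (in fact equality) for unitary-like
`a` — `x − a⁻¹ya = a⁻¹(axa⁻¹ − y)a`. -/
theorem norm_sub_conj_le_symm {a : Rˣ} (ha : UnitaryLike a) (x y : R) :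
    ‖x - ((a⁻¹ : Rˣ) : R) * y * a‖ ≤ ‖y - ((a : R) * x * ↑a⁻¹)‖ := by
  have e1 : x - ((a⁻¹ : Rˣ) : R) * y * a = ((a⁻¹ : Rˣ) : R) * ((a : R) * x * ↑a⁻¹ - y) * a := by
    have h1 : ((a⁻¹ : Rˣ) : R) * (a : R) = 1 := Units.inv_mul a
    have h2 : (a : R) * ((a⁻¹ : Rˣ) : R) = 1 := Units.mul_inv a
    calc x - ((a⁻¹ : Rˣ) : R) * y * a
        = ((a⁻¹ : Rˣ) : R) * (a : R) * x * (((a⁻¹ : Rˣ) : R) * (a : R)) - ((a⁻¹ : Rˣ) : R) * y * a := by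
          rw [h1, one_mul, mul_one]
      _ = _ := by noncomm_ring
  rw [e1, norm_sub_rev y]
  have ha' : UnitaryLike a⁻¹ := ha.inv
  calc _ ≤ ‖((a⁻¹ : Rˣ) : R) * ((a : R) * x * ↑a⁻¹ - y)‖ := by
        simpa using norm_mul_unit_le ha (((a⁻¹ : Rˣ) : R) * ((a : R) * x * ↑a⁻¹ - y))
    _ ≤ _ := norm_unit_mul_le ha' _

/-- [folklore] THE WORD OF ONE MIXED PLAQUETTE: for unitary-like units,
`‖P⁻¹·W₁·(a·W₂·a⁻¹)·P₀·(c·W₃⁻¹·c⁻¹) − a·W₂·a⁻¹‖ ≤ ‖P − 1‖ + ‖W₁ − 1‖ + ‖P₀ − 1‖ + ‖W₃ − 1‖` — with `X = P⁻¹W₁`,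
`Y = aW₂a⁻¹`, `Z = P₀·cW₃⁻¹c⁻¹`: `XYZ − Y = (X − 1)YZ + Y(Z − 1)`, `Y`, `Z` of norm `≤ 1` (nothing is asked of `W₁`). -/
theorem norm_step_word_sub_le [NormOneClass R] {P W₂ W₃ P₀ a c : Rˣ} (hP : UnitaryLike P) (hW₂ : UnitaryLike W₂)
    (hW₃ : UnitaryLike W₃) (hP₀ : UnitaryLike P₀) (ha : UnitaryLike a) (hc : UnitaryLike c) (W₁ : Rˣ) :
    ‖((P⁻¹ * W₁ * (a * W₂ * a⁻¹) * P₀ * (c * W₃⁻¹ * c⁻¹) : Rˣ) : R) - ((a * W₂ * a⁻¹ : Rˣ) : R)‖ ≤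
      ‖(P : R) - 1‖ + ‖(W₁ : R) - 1‖ + ‖(P₀ : R) - 1‖ + ‖(W₃ : R) - 1‖ := by
  have hY : UnitaryLike (a * W₂ * a⁻¹) := (ha.mul hW₂).mul ha.inv
  have hK : UnitaryLike (c * W₃⁻¹ * c⁻¹) := (hc.mul hW₃.inv).mul hc.inv
  have hZ : UnitaryLike (P₀ * (c * W₃⁻¹ * c⁻¹)) := hP₀.mul hK
  have e1 : ((P⁻¹ * W₁ * (a * W₂ * a⁻¹) * P₀ * (c * W₃⁻¹ * c⁻¹) : Rˣ) : R) - ((a * W₂ * a⁻¹ : Rˣ) : R)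
      = (((P⁻¹ * W₁ : Rˣ) : R) - 1) * ((a * W₂ * a⁻¹ : Rˣ) : R) * ((P₀ * (c * W₃⁻¹ * c⁻¹) : Rˣ) : R)
        + ((a * W₂ * a⁻¹ : Rˣ) : R) * (((P₀ * (c * W₃⁻¹ * c⁻¹) : Rˣ) : R) - 1) := by
    simp only [Units.val_mul]; noncomm_ring
  rw [e1]
  have h1 : ‖(((P⁻¹ * W₁ : Rˣ) : R) - 1) * ((a * W₂ * a⁻¹ : Rˣ) : R) * ((P₀ * (c * W₃⁻¹ * c⁻¹) : Rˣ) : R)‖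
      ≤ ‖((P⁻¹ * W₁ : Rˣ) : R) - 1‖ := (norm_mul_unit_le hZ _).trans (norm_mul_unit_le hY _)
  have h2 : ‖((a * W₂ * a⁻¹ : Rˣ) : R) * (((P₀ * (c * W₃⁻¹ * c⁻¹) : Rˣ) : R) - 1)‖
      ≤ ‖((P₀ * (c * W₃⁻¹ * c⁻¹) : Rˣ) : R) - 1‖ := norm_unit_mul_le hY _
  have hX : ‖((P⁻¹ * W₁ : Rˣ) : R) - 1‖ ≤ ‖(W₁ : R) - 1‖ + ‖(P : R) - 1‖ := by
    rw [Units.val_mul]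
    exact (T4AxialChain.norm_mul_sub_one_le_add hP.2 _).trans (add_le_add le_rfl (norm_inv_sub_one_le hP))
  have hZ' : ‖((P₀ * (c * W₃⁻¹ * c⁻¹) : Rˣ) : R) - 1‖ ≤ ‖(W₃ : R) - 1‖ + ‖(P₀ : R) - 1‖ := by
    have hK' : ‖((c * W₃⁻¹ * c⁻¹ : Rˣ) : R) - 1‖ ≤ ‖(W₃ : R) - 1‖ := by
      rw [Units.val_mul, Units.val_mul, norm_conj_sub_one_eq hc]
      exact norm_inv_sub_one_le hW₃
    have h := T4AxialChain.norm_mul_sub_one_le_add hP₀.1 ((c * W₃⁻¹ * c⁻¹ : Rˣ) : R)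
    rw [← Units.val_mul] at h
    exact h.trans (add_le_add hK' le_rfl)
  calc _ ≤ ‖(((P⁻¹ * W₁ : Rˣ) : R) - 1) * ((a * W₂ * a⁻¹ : Rˣ) : R) * ((P₀ * (c * W₃⁻¹ * c⁻¹) : Rˣ) : R)‖
          + ‖((a * W₂ * a⁻¹ : Rˣ) : R) * (((P₀ * (c * W₃⁻¹ * c⁻¹) : Rˣ) : R) - 1)‖ := norm_add_le _ _
    _ ≤ ‖((P⁻¹ * W₁ : Rˣ) : R) - 1‖ + ‖((P₀ * (c * W₃⁻¹ * c⁻¹) : Rˣ) : R) - 1‖ := add_le_add h1 h2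
    _ ≤ _ := by linarith

/-! ## §2  The perturbation `V′ = V·U₀⁻¹`, relative axial gauge as DATA (`TreeRel`), the interior bound for given data -/

/-- [cite: Balaban1985RegularSpaces, Lemma 1 p. 79] Bałaban's `V′` for the pair `(V₀, V′V₀) = (U₀, V)`: the bond-wise
ratio `V⟨x, x+e_ν⟩·U₀⟨x, x+e_ν⟩⁻¹` (for `V = U₁^g`, `g` the comb gauge, this is `T4RelativeComb.defect`). [folklore] -/
def pert (U₀ V : Cfg d R) (x : Site d) (ν : Fin d) : Rˣ := V x ν * (U₀ x ν)⁻¹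

/-- [folklore] `V′·V₀ = V` bond-wise. -/
theorem pert_mul (U₀ V : Cfg d R) (x : Site d) (ν : Fin d) : pert U₀ V x ν * U₀ x ν = V x ν := by
  simp [pert]

/-- [folklore] `V′` of a unitary-like pair is unitary-like. -/
theorem unitaryLike_pert {U₀ V : Cfg d R} (hU₀ : ∀ x ν, UnitaryLike (U₀ x ν)) (hV : ∀ x ν, UnitaryLike (V x ν))
    (x : Site d) (ν : Fin d) : UnitaryLike (pert U₀ V x ν) :=
  (hV x ν).mul (hU₀ x ν).inv

/-- [cite: Balaban1985RegularSpaces, (1.24) p. 79] RELATIVE AXIAL GAUGE AS DATA on the block `B(z)`: "(R(V₀)V′)(Γ_{z,x}) =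
1 for x ∈ B(z)" in the bond-wise form "V′_b = 1 for b ⊂ Γ_{z,x}" — `V = U₀` on every tree bond `⟨z+k, z+k+e_ρ⟩`
(`IsTree k ρ`) with both ends in `B(z)`. [folklore] -/
def TreeRel (L : ℕ) (z : Site d) (U₀ V : Cfg d R) : Prop :=
  ∀ (k : Fin d → ℕ) (ρ : Fin d), (∀ κ, k κ < L) → k ρ + 1 < L → IsTree k ρ → V (site z k) ρ = U₀ (site z k) ρ

/-- [folklore] On a tree bond of the block, `V′ = 1`. -/
theorem pert_tree {L : ℕ} {z : Site d} {U₀ V : Cfg d R} (hT : TreeRel L z U₀ V) {k : Fin d → ℕ} {ρ : Fin d}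
    (hk : ∀ κ, k κ < L) (hρ : k ρ + 1 < L) (ht : IsTree k ρ) : pert U₀ V (site z k) ρ = 1 := by
  rw [pert, hT k ρ hk hρ ht, mul_inv_cancel]

/-- [folklore] THE COMB GAUGE PRODUCES SUCH DATA: `(U₀, U₁^g)` with `g = combGauge U₀ U₁ z` satisfies `TreeRel` on
`B(z)` for every `L` (`T4RelativeComb.gaugeAct_combGauge_tree` BY NAME). -/
theorem treeRel_comb (L : ℕ) (z : Site d) (U₀ U₁ : Cfg d R) : TreeRel L z U₀ (gaugeAct (combGauge U₀ U₁ z) U₁) :=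
  fun _ _ _ _ ht => gaugeAct_combGauge_tree U₀ U₁ z ht

/-- [folklore] Under `TreeRel` the ordered holonomies of `V` and `U₀` along the staircase tree to any site of the block
AGREE: `V(Γ_{z,z+k}) = U₀(Γ_{z,z+k})` (induction on the path; every bond of `Γ_{z,z+k}` is a tree bond with both ends in
the block). -/
theorem hol_congr_of_treeRel {L : ℕ} {z : Site d} {U₀ V : Cfg d R} (hT : TreeRel L z U₀ V) :
    ∀ k : Fin d → ℕ, (∀ κ, k κ < L) → hol V z k = hol U₀ z k := by
  suffices H : ∀ n (k : Fin d → ℕ), ∑ ρ, k ρ = n → (∀ κ, k κ < L) → hol V z k = hol U₀ z k from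
    fun k hk => H _ k rfl hk
  intro n
  induction n with
  | zero =>
      intro k hk _
      have hk0 : k = 0 := by
        funext κ; exact (Finset.sum_eq_zero_iff.1 hk) κ (mem_univ κ)
      subst hk0; rw [hol_zero, hol_zero]
  | succ n ih =>
      intro k hk hkL
      obtain ⟨ρ₁, -, hρ₁⟩ : ∃ ρ ∈ (univ : Finset (Fin d)), k ρ ≠ 0 :=
        Finset.exists_ne_zero_of_sum_ne_zero (by omega)
      have h : ∃ ρ, k ρ ≠ 0 := ⟨ρ₁, hρ₁⟩
      have hn : ∑ ρ, pred' k h ρ = n := by have := sum_eq_sum_pred'_succ k h; omega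
      have hpL : ∀ κ, pred' k h κ < L := fun κ => (pred'_le k h κ).trans_lt (hkL κ)
      have step : ∀ U : Cfg d R, hol U z k = hol U z (pred' k h) * U (site z (pred' k h)) (low k h) := fun U => by
        conv_lhs => rw [← pred'_add_single k h]
        exact hol_succ U z (isTree_pred' k h)
      have hend : pred' k h (low k h) + 1 < L := by
        have h1 := congrFun (pred'_add_single k h) (low k h)
        simp only [Pi.add_apply, Pi.single_eq_same] at h1
        have h2 := hkL (low k h)
        omega
      rw [step V, step U₀, ih _ hn hpL, hT _ _ hpL hend (isTree_pred' k h)]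

/-- [folklore] Hence the relative comb gauge of `(U₀, V)` is the identity on the block: `combGauge U₀ V z (z+k) = 1`. -/
theorem combGauge_eq_one_of_treeRel {L : ℕ} {z : Site d} {U₀ V : Cfg d R} (hT : TreeRel L z U₀ V)
    (k : Fin d → ℕ) (hk : ∀ κ, k κ < L) : combGauge U₀ V z (site z k) = 1 := by
  rw [combGauge_site, relGauge, hol_congr_of_treeRel hT k hk, inv_mul_cancel]

/-- [folklore] … so on interior bonds the comb defect of `T4RelativeComb` IS `V′`: `defect U₀ V z x ν = pert U₀ V x ν`
for `x, x + e_ν ∈ B(z)`. -/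
theorem defect_eq_pert_of_treeRel {L : ℕ} {z : Site d} {U₀ V : Cfg d R} (hT : TreeRel L z U₀ V) {x : Site d}
    {ν : Fin d} (hx : InBlock L z x) (hxν : InBlock L z (x + e ν)) : defect U₀ V z x ν = pert U₀ V x ν := by
  obtain ⟨k, hk, rfl⟩ := exists_offset_of_inBlock hx
  have hk' : ∀ κ, (k + Pi.single ν 1 : Fin d → ℕ) κ < L := by
    rw [← site_add_single, inBlock_site_iff] at hxν; exact hxν
  simp only [defect, gaugeAct]
  rw [← site_add_single, combGauge_eq_one_of_treeRel hT k hk, combGauge_eq_one_of_treeRel hT _ hk', pert]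
  simp

/-- [cite: Balaban1985RegularSpaces, Lemma 1 (1.26) p. 79] THE INTERIOR BOUND FOR GIVEN GAUGE-FIXED DATA, NON-ABELIAN: if
`(U₀, V)` is in relative axial gauge on `B(z)` and both curvatures are `≤ q₀`, `≤ q_V` on the squares of `B(z)`, then
`‖V′ − 1‖ ≤ (d−1)(L−1)(q_V + q₀)` on every interior bond — "|V′_b − 1| < (d−1)(L−1)2α₀L⁻² for b ⊂ B(y)"
(`T4RelativeComb.interior_bound_crude` BY NAME, through `defect_eq_pert_of_treeRel`). [folklore] -/
theorem interior_bound_of_treeRel [NormOneClass R] {U₀ V : Cfg d R} {z : Site d} {L : ℕ} {qV q₀ : ℝ}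
    (hU₀ : ∀ x ν, UnitaryLike (U₀ x ν)) (hV : ∀ x ν, UnitaryLike (V x ν)) (hT : TreeRel L z U₀ V)
    (hqV : PlaqSup L z (fun y ρ ν => ‖(plaq V y ρ ν : R) - 1‖) qV)
    (hq₀ : PlaqSup L z (fun y ρ ν => ‖(plaq U₀ y ρ ν : R) - 1‖) q₀) (hq : 0 ≤ qV + q₀)
    (x : Site d) (ν : Fin d) (hx : InBlock L z x) (hxν : InBlock L z (x + e ν)) :
    ‖(pert U₀ V x ν : R) - 1‖ ≤ ((d : ℝ) - 1) * ((L : ℝ) - 1) * (qV + q₀) := by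
  rw [← defect_eq_pert_of_treeRel hT hx hxν]
  exact interior_bound_crude hU₀ hV hqV hq₀ hq x ν hx hxν

/-! ## §3  Two neighbouring blocks: the crossing bonds `B(c)` and the ONE-PLAQUETTE STEP with its transport -/

/-- [cite: Balaban1985RegularSpaces, (1.23) p. 79] The starting point `x_t = y + t + (L−1)e_μ ∈ B(c₋)` of the crossing bond
`⟨x_t, x_t + e_μ⟩ ∈ B(c)` at transverse position `t` (the bond of `B8Lemma1Lattice.crossVal`). [folklore] -/
def crossSite (L : ℕ) (y : Site d) (μ : Fin d) (t : Trans d L μ) : Site d := site y (offset μ t (L - 1))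

/-- [folklore] `x_t ∈ B(c₋)`. -/
theorem crossSite_inBlock {L : ℕ} (hL : 1 ≤ L) (y : Site d) (μ : Fin d) (t : Trans d L μ) :
    InBlock L y (crossSite L y μ t) :=
  (inBlock_site_iff L y _).2 (offset_lt μ t (by omega))

/-- [folklore] `x_t + e_μ ∈ B(c₊)`: it is the site of `B(c₊)` with the same transverse position and longitudinal
coordinate `0`. -/
theorem crossSite_add_e {L : ℕ} (hL : 1 ≤ L) (y : Site d) (μ : Fin d) (t : Trans d L μ) :
    crossSite L y μ t + e μ = site (yplus L y μ) (offset μ t 0) := by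
  rw [crossSite, ← site_add_single, offset_add_single, ← site_offset_add, show L - 1 + 1 = 0 + L by omega]

/-- [folklore] `x_t + e_μ ∈ B(c₊)`. -/
theorem crossSite_add_e_inBlock {L : ℕ} (hL : 1 ≤ L) (y : Site d) (μ : Fin d) (t : Trans d L μ) :
    InBlock L (yplus L y μ) (crossSite L y μ t + e μ) := by
  rw [crossSite_add_e hL]; exact (inBlock_site_iff L _ _).2 (offset_lt μ t (by omega))

/-- [folklore] One transverse step `u = t + e_ν`: `x_u = x_t + e_ν`. -/
theorem crossSite_step {L : ℕ} (y : Site d) (μ : Fin d) {t u : Trans d L μ} (ν : {ν : Fin d // ν ≠ μ})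
    (hu : ∀ κ, κ ≠ ν → u κ = t κ) (hν : (u ν : ℕ) = t ν + 1) :
    crossSite L y μ t + e ν.1 = crossSite L y μ u := by
  rw [crossSite, crossSite, offset_step μ ν hu hν, site_add_single]

/-- [cite: Balaban1985RegularSpaces, (1.22) and Lemma 1 proof p. 79] THE EXACT STEP IDENTITY through the mixed plaquette
`p = (x; ν, μ)` (bonds `⟨x,x+e_ν⟩ ∈ B(c₋)`, `b″ = ⟨x+e_ν, ·+e_μ⟩`, `⟨x+e_μ, ·+e_ν⟩ ∈ B(c₊)`, `b′ = ⟨x, x+e_μ⟩`):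
`V′(b′) = V(∂p)⁻¹ · V′⟨x,x+e_ν⟩ · (U₀⟨x,x+e_ν⟩·V′(b″)·U₀⟨x,x+e_ν⟩⁻¹) · U₀(∂p) · (U₀(b′)·V′⟨x+e_μ,·+e_ν⟩⁻¹·U₀(b′)⁻¹)` — a
free-group identity in the eight bond variables (`group`); the middle factor is "R(V₀(b′₋, b″₋))V′_{b″}". [folklore] -/
theorem pert_cross_identity (U₀ V : Cfg d R) (x : Site d) (ν μ : Fin d) :
    pert U₀ V x μ = (plaq V x ν μ)⁻¹ * pert U₀ V x ν * (U₀ x ν * pert U₀ V (x + e ν) μ * (U₀ x ν)⁻¹) *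
      plaq U₀ x ν μ * (U₀ x μ * (pert U₀ V (x + e μ) ν)⁻¹ * (U₀ x μ)⁻¹) := by
  simp only [pert, plaq]
  group

/-- [cite: Balaban1985RegularSpaces, Lemma 1 proof p. 79] "|R(V₀(b′₋, b″₋))V′_{b″} − V′_{b′}| < 2α₀L⁻² + 4(d−1)α₀L⁻¹", the
four-term form: `‖V′(b′) − U₀⟨x,x+e_ν⟩V′(b″)U₀⟨x,x+e_ν⟩⁻¹‖ ≤ ‖V(∂p) − 1‖ + ‖V′⟨x,x+e_ν⟩ − 1‖ + ‖U₀(∂p) − 1‖ +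
‖V′⟨x+e_μ,·+e_ν⟩ − 1‖` for a unitary-like pair (`pert_cross_identity` + `norm_step_word_sub_le`). [folklore] -/
theorem norm_pert_cross_sub_transport_le [NormOneClass R] {U₀ V : Cfg d R} (hU₀ : ∀ x ν, UnitaryLike (U₀ x ν))
    (hV : ∀ x ν, UnitaryLike (V x ν)) (x : Site d) (ν μ : Fin d) :
    ‖(pert U₀ V x μ : R) - ((U₀ x ν * pert U₀ V (x + e ν) μ * (U₀ x ν)⁻¹ : Rˣ) : R)‖ ≤
      ‖(plaq V x ν μ : R) - 1‖ + ‖(pert U₀ V x ν : R) - 1‖ + ‖(plaq U₀ x ν μ : R) - 1‖ +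
        ‖(pert U₀ V (x + e μ) ν : R) - 1‖ := by
  rw [pert_cross_identity U₀ V x ν μ]
  exact norm_step_word_sub_le (unitaryLike_plaq hV x ν μ) (unitaryLike_pert hU₀ hV _ μ)
    (unitaryLike_pert hU₀ hV _ ν) (unitaryLike_plaq hU₀ x ν μ) (hU₀ x ν) (hU₀ x μ) _

/-- [folklore] A bound `F ≤ b` on every plaquette with all four corners in the region `B(c₋) ∪ B(c₊)` (the multiplicative
twin of `B8Lemma1Lattice.PlaqBoundPair`, in the format of `T4RelativeComb.PlaqSup`). -/
def PlaqSupPair (L : ℕ) (y : Site d) (μ : Fin d) (F : Site d → Fin d → Fin d → ℝ) (b : ℝ) : Prop :=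
  ∀ x : Site d, ∀ ρ ν : Fin d, ρ ≠ ν → InPair L y μ x → InPair L y μ (x + e ρ) → InPair L y μ (x + e ν) →
    InPair L y μ (x + e ρ + e ν) → F x ρ ν ≤ b

/-- [folklore] A bound on the region restricts to `B(c₋)`. -/
theorem plaqSupPair_left {L : ℕ} {y : Site d} {μ : Fin d} {F : Site d → Fin d → Fin d → ℝ} {b : ℝ}
    (h : PlaqSupPair L y μ F b) : PlaqSup L y F b :=
  fun x ρ ν hρν h1 h2 h3 h4 => h x ρ ν hρν (Or.inl h1) (Or.inl h2) (Or.inl h3) (Or.inl h4)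

/-- [folklore] A bound on the region restricts to `B(c₊)`. -/
theorem plaqSupPair_right {L : ℕ} {y : Site d} {μ : Fin d} {F : Site d → Fin d → Fin d → ℝ} {b : ℝ}
    (h : PlaqSupPair L y μ F b) : PlaqSup L (yplus L y μ) F b :=
  fun x ρ ν hρν h1 h2 h3 h4 => h x ρ ν hρν (Or.inr h1) (Or.inr h2) (Or.inr h3) (Or.inr h4)

/-- [cite: Balaban1985RegularSpaces, Lemma 1 proof p. 79] THE STEP ON THE LATTICE (oriented, `u = t + e_ν`): with curvature
sups `q_V, q₀` on the plaquettes of `B(c₋) ∪ B(c₊)` and interior defect bounds `I₋` on `B(c₋)`, `I₊` on `B(c₊)`,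
`‖V′(b_t) − U₀⟨x_t, x_u⟩·V′(b_u)·U₀⟨x_t, x_u⟩⁻¹‖ ≤ q_V + q₀ + I₋ + I₊` — the printed "2α₀L⁻² + 4(d−1)α₀L⁻¹" with
`q_V + q₀ = 2α₀L⁻²` and `I₋ = I₊ = (d−1)(L−1)2α₀L⁻²`.  The four bonds of the mixed plaquette `(x_t; ν, μ)` are placed in
the region exactly as in `B8Lemma1Lattice.crossVal_step`. [folklore] -/
theorem cross_step [NormOneClass R] {U₀ V : Cfg d R} {L : ℕ} {y : Site d} {μ : Fin d} {qV q₀ Im Ip : ℝ}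
    (hU₀ : ∀ x ν, UnitaryLike (U₀ x ν)) (hV : ∀ x ν, UnitaryLike (V x ν)) (hL : 1 ≤ L)
    (hqV : PlaqSupPair L y μ (fun x ρ ν => ‖(plaq V x ρ ν : R) - 1‖) qV)
    (hq₀ : PlaqSupPair L y μ (fun x ρ ν => ‖(plaq U₀ x ρ ν : R) - 1‖) q₀)
    (hIm : ∀ x ν, InBlock L y x → InBlock L y (x + e ν) → ‖(pert U₀ V x ν : R) - 1‖ ≤ Im)
    (hIp : ∀ x ν, InBlock L (yplus L y μ) x → InBlock L (yplus L y μ) (x + e ν) → ‖(pert U₀ V x ν : R) - 1‖ ≤ Ip)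
    {t u : Trans d L μ} (ν : {ν : Fin d // ν ≠ μ}) (hu : ∀ κ, κ ≠ ν → u κ = t κ) (hν : (u ν : ℕ) = t ν + 1) :
    ‖(pert U₀ V (crossSite L y μ t) μ : R) -
        ((U₀ (crossSite L y μ t) ν.1 * pert U₀ V (crossSite L y μ u) μ * (U₀ (crossSite L y μ t) ν.1)⁻¹ : Rˣ) : R)‖
      ≤ qV + q₀ + Im + Ip := by
  have hL1 : L - 1 < L := by omega
  have hqlt : ∀ κ, offset μ t (L - 1) κ < L := offset_lt μ t hL1
  have hqν : offset μ t (L - 1) ν.1 + 1 < L := by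
    rw [offset_apply_sub]; have := (u ν).isLt; omega
  have hx0 : InBlock L y (crossSite L y μ t) := crossSite_inBlock hL y μ t
  have hx1 : InBlock L y (crossSite L y μ t + e ν.1) := by
    rw [crossSite, ← site_add_single]; exact (inBlock_site_iff L y _).2 (lt_of_add_single hqlt hqν)
  have hx2 : InBlock L (yplus L y μ) (crossSite L y μ t + e μ) := crossSite_add_e_inBlock hL y μ t
  have hx3 : InBlock L (yplus L y μ) (crossSite L y μ t + e μ + e ν.1) := by
    rw [crossSite_add_e hL, ← site_add_single]
    refine (inBlock_site_iff L _ _).2 (lt_of_add_single (offset_lt μ t (by omega)) ?_)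
    rw [offset_apply_sub]; have := (u ν).isLt; omega
  have hx3' : InPair L y μ (crossSite L y μ t + e ν.1 + e μ) := by
    rw [add_assoc, add_comm (e ν.1), ← add_assoc]; exact Or.inr hx3
  have hP : ‖(plaq V (crossSite L y μ t) ν.1 μ : R) - 1‖ ≤ qV :=
    hqV _ ν.1 μ ν.2 (Or.inl hx0) (Or.inl hx1) (Or.inr hx2) hx3'
  have hP₀ : ‖(plaq U₀ (crossSite L y μ t) ν.1 μ : R) - 1‖ ≤ q₀ :=
    hq₀ _ ν.1 μ ν.2 (Or.inl hx0) (Or.inl hx1) (Or.inr hx2) hx3'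
  have h1 : ‖(pert U₀ V (crossSite L y μ t) ν.1 : R) - 1‖ ≤ Im := hIm _ ν.1 hx0 hx1
  have h3 : ‖(pert U₀ V (crossSite L y μ t + e μ) ν.1 : R) - 1‖ ≤ Ip := hIp _ ν.1 hx2 hx3
  rw [← crossSite_step y μ ν hu hν]
  calc _ ≤ _ := norm_pert_cross_sub_transport_le hU₀ hV (crossSite L y μ t) ν.1 μ
    _ ≤ qV + Im + q₀ + Ip := add_le_add (add_le_add (add_le_add hP h1) hP₀) h3
    _ = qV + q₀ + Im + Ip := by ring

/-- [cite: Balaban1985RegularSpaces, Lemma 1 proof p. 79] THE STEP, both orientations of `B8Lemma1Lattice.StepAdj`: there is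
a unitary-like transport `a` (`U₀⟨x_t, x_u⟩` or its inverse) with `‖V′(b_t) − a·V′(b_u)·a⁻¹‖ ≤ q_V + q₀ + I₋ + I₊`. [folklore] -/
theorem cross_step_adj [NormOneClass R] {U₀ V : Cfg d R} {L : ℕ} {y : Site d} {μ : Fin d} {qV q₀ Im Ip : ℝ}
    (hU₀ : ∀ x ν, UnitaryLike (U₀ x ν)) (hV : ∀ x ν, UnitaryLike (V x ν)) (hL : 1 ≤ L)
    (hqV : PlaqSupPair L y μ (fun x ρ ν => ‖(plaq V x ρ ν : R) - 1‖) qV)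
    (hq₀ : PlaqSupPair L y μ (fun x ρ ν => ‖(plaq U₀ x ρ ν : R) - 1‖) q₀)
    (hIm : ∀ x ν, InBlock L y x → InBlock L y (x + e ν) → ‖(pert U₀ V x ν : R) - 1‖ ≤ Im)
    (hIp : ∀ x ν, InBlock L (yplus L y μ) x → InBlock L (yplus L y μ) (x + e ν) → ‖(pert U₀ V x ν : R) - 1‖ ≤ Ip)
    {t u : Trans d L μ} (hadj : StepAdj t u) :
    ∃ a : Rˣ, UnitaryLike a ∧
      ‖(pert U₀ V (crossSite L y μ t) μ : R) - ((a * pert U₀ V (crossSite L y μ u) μ * a⁻¹ : Rˣ) : R)‖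
        ≤ qV + q₀ + Im + Ip := by
  obtain ⟨ν, hu, hν | hν⟩ := hadj
  · exact ⟨_, hU₀ _ _, cross_step hU₀ hV hL hqV hq₀ hIm hIp ν hu hν⟩
  · have h := cross_step hU₀ hV hL hqV hq₀ hIm hIp ν (fun κ hκ => (hu κ hκ).symm) hν
    refine ⟨(U₀ (crossSite L y μ u) ν.1)⁻¹, (hU₀ _ _).inv, ?_⟩
    rw [Units.val_mul, Units.val_mul] at h
    rw [Units.val_mul, Units.val_mul, inv_inv]
    exact (norm_sub_conj_le_symm (hU₀ _ _) _ _).trans h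

/-! ## §4  The chain along `B(c)`: transports compose, `(d−1)(L−1)` steps -/

/-- [cite: Balaban1985RegularSpaces, Lemma 1 proof p. 79] "Thus |R(V₀(Γ_{b₀,₋,b₋}))V′_b − V′_{b₀}| < (d−1)(L−1)·4dα₀L⁻¹": along a
chain of `n` transverse steps the one-step transports COMPOSE to a unitary-like `P` with `‖V′(b_t) − P·V′(b_u)·P⁻¹‖ ≤ n·s`,
`s = q_V + q₀ + I₋ + I₊` (induction on `B8Lemma1Abelian.Reach`; conjugation contracts differences). [folklore] -/
theorem cross_chain [NormOneClass R] {U₀ V : Cfg d R} {L : ℕ} {y : Site d} {μ : Fin d} {qV q₀ Im Ip : ℝ}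
    (hU₀ : ∀ x ν, UnitaryLike (U₀ x ν)) (hV : ∀ x ν, UnitaryLike (V x ν)) (hL : 1 ≤ L)
    (hqV : PlaqSupPair L y μ (fun x ρ ν => ‖(plaq V x ρ ν : R) - 1‖) qV)
    (hq₀ : PlaqSupPair L y μ (fun x ρ ν => ‖(plaq U₀ x ρ ν : R) - 1‖) q₀)
    (hIm : ∀ x ν, InBlock L y x → InBlock L y (x + e ν) → ‖(pert U₀ V x ν : R) - 1‖ ≤ Im)
    (hIp : ∀ x ν, InBlock L (yplus L y μ) x → InBlock L (yplus L y μ) (x + e ν) → ‖(pert U₀ V x ν : R) - 1‖ ≤ Ip) :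
    ∀ {n : ℕ} {t u : Trans d L μ}, Reach StepAdj n t u →
      ∃ P : Rˣ, UnitaryLike P ∧
        ‖(pert U₀ V (crossSite L y μ t) μ : R) - ((P * pert U₀ V (crossSite L y μ u) μ * P⁻¹ : Rˣ) : R)‖
          ≤ (n : ℝ) * (qV + q₀ + Im + Ip) := by
  intro n t u h
  induction h with
  | refl t => exact ⟨1, UnitaryLike.one, by simp⟩
  | step hadj _ ih =>
      obtain ⟨a, ha, h1⟩ := cross_step_adj hU₀ hV hL hqV hq₀ hIm hIp hadj
      obtain ⟨P, hP, h2⟩ := ih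
      refine ⟨a * P, ha.mul hP, ?_⟩
      rename_i n' t' u' v' _
      have e1 : ((a * P) * pert U₀ V (crossSite L y μ v') μ * (a * P)⁻¹ : Rˣ) =
          a * (P * pert U₀ V (crossSite L y μ v') μ * P⁻¹) * a⁻¹ := by
        rw [mul_inv_rev]; simp only [mul_assoc]
      rw [e1]
      calc _ ≤ ‖(pert U₀ V (crossSite L y μ t') μ : R) - ((a * pert U₀ V (crossSite L y μ u') μ * a⁻¹ : Rˣ) : R)‖
              + ‖((a * pert U₀ V (crossSite L y μ u') μ * a⁻¹ : Rˣ) : R)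
                  - ((a * (P * pert U₀ V (crossSite L y μ v') μ * P⁻¹) * a⁻¹ : Rˣ) : R)‖ :=
            norm_sub_le_norm_sub_add_norm_sub _ _ _
        _ ≤ (qV + q₀ + Im + Ip)
              + ‖(pert U₀ V (crossSite L y μ u') μ : R) - ((P * pert U₀ V (crossSite L y μ v') μ * P⁻¹ : Rˣ) : R)‖ := by
            refine add_le_add h1 ?_
            simp only [Units.val_mul]
            exact norm_conj_sub_conj_le ha _ _
        _ ≤ (qV + q₀ + Im + Ip) + (n' : ℝ) * (qV + q₀ + Im + Ip) := add_le_add le_rfl h2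
        _ = ((n' + 1 : ℕ) : ℝ) * (qV + q₀ + Im + Ip) := by push_cast; ring

/-- [cite: Balaban1985RegularSpaces, Lemma 1 proof p. 79] "… for an arbitrary bond b ∈ B(c)": ANY two crossing bonds are
related by a unitary-like transport up to `(d−1)(L−1)·(q_V + q₀ + I₋ + I₊)` (`reach_of_dist1`, `dist1_le` BY NAME).
[folklore] -/
theorem cross_any [NormOneClass R] {U₀ V : Cfg d R} {L : ℕ} {y : Site d} {μ : Fin d} {qV q₀ Im Ip : ℝ}
    (hU₀ : ∀ x ν, UnitaryLike (U₀ x ν)) (hV : ∀ x ν, UnitaryLike (V x ν)) (hL : 1 ≤ L)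
    (hqV : PlaqSupPair L y μ (fun x ρ ν => ‖(plaq V x ρ ν : R) - 1‖) qV)
    (hq₀ : PlaqSupPair L y μ (fun x ρ ν => ‖(plaq U₀ x ρ ν : R) - 1‖) q₀)
    (hIm : ∀ x ν, InBlock L y x → InBlock L y (x + e ν) → ‖(pert U₀ V x ν : R) - 1‖ ≤ Im)
    (hIp : ∀ x ν, InBlock L (yplus L y μ) x → InBlock L (yplus L y μ) (x + e ν) → ‖(pert U₀ V x ν : R) - 1‖ ≤ Ip)
    (hs : 0 ≤ qV + q₀ + Im + Ip) (t u : Trans d L μ) :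
    ∃ P : Rˣ, UnitaryLike P ∧
      ‖(pert U₀ V (crossSite L y μ t) μ : R) - ((P * pert U₀ V (crossSite L y μ u) μ * P⁻¹ : Rˣ) : R)‖
        ≤ ((d : ℝ) - 1) * ((L : ℝ) - 1) * (qV + q₀ + Im + Ip) := by
  obtain ⟨P, hP, h⟩ := cross_chain hU₀ hV hL hqV hq₀ hIm hIp (reach_of_dist1 u _ t rfl)
  refine ⟨P, hP, h.trans (mul_le_mul_of_nonneg_right ?_ hs)⟩
  have hd : 1 ≤ d := by have := μ.isLt; omega
  have h1 : ((B8Lemma1Lattice.dist1 t u : ℕ) : ℝ) ≤ (((d - 1) * (L - 1) : ℕ) : ℝ) := by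
    exact_mod_cast dist1_le t u
  rw [Nat.cast_mul, Nat.cast_sub hd, Nat.cast_sub hL, Nat.cast_one] at h1
  exact h1

/-- [cite: Balaban1985RegularSpaces, Lemma 1 proof p. 79] … hence in `‖· − 1‖` (conjugation isometry):
`‖V′(b) − 1‖ ≤ ‖V′(b′) − 1‖ + (d−1)(L−1)·(q_V + q₀ + I₋ + I₊)` for any two crossing bonds `b, b′ ∈ B(c)`. [folklore] -/
theorem norm_cross_sub_one_le [NormOneClass R] {U₀ V : Cfg d R} {L : ℕ} {y : Site d} {μ : Fin d} {qV q₀ Im Ip : ℝ}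
    (hU₀ : ∀ x ν, UnitaryLike (U₀ x ν)) (hV : ∀ x ν, UnitaryLike (V x ν)) (hL : 1 ≤ L)
    (hqV : PlaqSupPair L y μ (fun x ρ ν => ‖(plaq V x ρ ν : R) - 1‖) qV)
    (hq₀ : PlaqSupPair L y μ (fun x ρ ν => ‖(plaq U₀ x ρ ν : R) - 1‖) q₀)
    (hIm : ∀ x ν, InBlock L y x → InBlock L y (x + e ν) → ‖(pert U₀ V x ν : R) - 1‖ ≤ Im)
    (hIp : ∀ x ν, InBlock L (yplus L y μ) x → InBlock L (yplus L y μ) (x + e ν) → ‖(pert U₀ V x ν : R) - 1‖ ≤ Ip)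
    (hs : 0 ≤ qV + q₀ + Im + Ip) (t u : Trans d L μ) :
    ‖(pert U₀ V (crossSite L y μ t) μ : R) - 1‖ ≤
      ‖(pert U₀ V (crossSite L y μ u) μ : R) - 1‖ + ((d : ℝ) - 1) * ((L : ℝ) - 1) * (qV + q₀ + Im + Ip) := by
  obtain ⟨P, hP, h⟩ := cross_any hU₀ hV hL hqV hq₀ hIm hIp hs t u
  calc _ ≤ ‖(pert U₀ V (crossSite L y μ t) μ : R) - ((P * pert U₀ V (crossSite L y μ u) μ * P⁻¹ : Rˣ) : R)‖
          + ‖((P * pert U₀ V (crossSite L y μ u) μ * P⁻¹ : Rˣ) : R) - 1‖ := norm_sub_le_norm_sub_add_norm_sub _ _ _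
    _ ≤ _ := by
        have e1 : ‖((P * pert U₀ V (crossSite L y μ u) μ * P⁻¹ : Rˣ) : R) - 1‖ =
            ‖(pert U₀ V (crossSite L y μ u) μ : R) - 1‖ := by
          rw [Units.val_mul, Units.val_mul, norm_conj_sub_one_eq hP]
        rw [e1, add_comm]
        exact add_le_add le_rfl h

/-! ## §5  The corner contour `Γ_{c,c₋} = [y, y + Le_μ]` and the crossing bond `b₀` on it -/

/-- [folklore] The transverse position `t = 0` (the line of the coarse bond `c` through the two corners). -/
def tzero {L : ℕ} (μ : Fin d) (hL : 1 ≤ L) : Trans d L μ := fun _ => ⟨0, hL⟩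

/-- [folklore] Offsets on the line of `c`: `offset μ tzero h = h·e_μ`. -/
theorem offset_tzero {L : ℕ} (μ : Fin d) (hL : 1 ≤ L) (h : ℕ) : offset μ (tzero μ hL) h = Pi.single μ h := by
  funext κ
  by_cases hκ : κ = μ
  · subst hκ; rw [offset_apply_mu, Pi.single_eq_same]
  · rw [offset_apply_ne μ _ h hκ, Pi.single_eq_of_ne hκ]; rfl

/-- [cite: Balaban1985RegularSpaces, Lemma 1 proof p. 79] "b₀ being the unique bond of c belonging to B(c)": `b₀ =
⟨y + (L−1)e_μ, y + Le_μ⟩` is the crossing bond at `t = 0`. [folklore] -/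
theorem crossSite_tzero {L : ℕ} (y : Site d) (μ : Fin d) (hL : 1 ≤ L) :
    crossSite L y μ (tzero μ hL) = site y (Pi.single μ (L - 1)) := by
  rw [crossSite, offset_tzero]

/-- [folklore] The bonds of the line `[y, y + Le_μ]` are tree bonds (all coordinates below `μ` vanish). -/
theorem isTree_single (μ : Fin d) (j : ℕ) : IsTree (Pi.single μ j : Fin d → ℕ) μ := by
  intro κ hκ
  have hne : κ ≠ μ := fun h => by rw [h] at hκ; exact lt_irrefl _ hκ
  simp [Pi.single_eq_of_ne hne]

/-- [folklore] The straight holonomy grows one bond at a time: `U([y, y+(j+1)e_μ]) = U([y, y+je_μ])·U⟨y+je_μ, ·+e_μ⟩`. -/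
theorem hol_single_succ (U : Cfg d R) (y : Site d) (μ : Fin d) (j : ℕ) :
    hol U y (Pi.single μ (j + 1)) = hol U y (Pi.single μ j) * U (site y (Pi.single μ j)) μ := by
  rw [← hol_succ U y (isTree_single μ j), ← Pi.single_add]

/-- [cite: Balaban1985Averaging, (42) p. 23; Balaban1985RegularSpaces, Lemma 1 proof pp. 79–80] THE CORNER CONTOUR
IDENTITY: in relative axial gauge on `B(c₋)` the `L − 1` tree bonds of `Γ_{c,c₋} = [y, y + Le_μ]` carry `V = U₀`, so
`V(c)·U₀(c)⁻¹ = U₀([c₋, b₀,₋])·V′(b₀)·U₀([c₋, b₀,₋])⁻¹` EXACTLY — the element "R(V₀([c₋, b₀,₋]))V′_{b₀}" of the printed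
last step. [folklore] -/
theorem corner_contour {L : ℕ} {y : Site d} {μ : Fin d} {U₀ V : Cfg d R} (hL : 1 ≤ L) (hT : TreeRel L y U₀ V) :
    hol V y (Pi.single μ L) * (hol U₀ y (Pi.single μ L))⁻¹ =
      hol U₀ y (Pi.single μ (L - 1)) * pert U₀ V (site y (Pi.single μ (L - 1))) μ *
        (hol U₀ y (Pi.single μ (L - 1)))⁻¹ := by
  obtain ⟨L', rfl⟩ : ∃ L', L = L' + 1 := ⟨L - 1, by omega⟩
  have hblk : ∀ κ, (Pi.single μ L' : Fin d → ℕ) κ < L' + 1 := by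
    intro κ; by_cases hκ : κ = μ
    · subst hκ; simp
    · simp [Pi.single_eq_of_ne hκ]
  rw [Nat.add_sub_cancel, hol_single_succ, hol_single_succ, hol_congr_of_treeRel hT _ hblk, pert]
  group

/-- [cite: Balaban1985RegularSpaces, Lemma 1 proof pp. 79–80] … so the coarse-bond holonomy ratio measures exactly the corner
crossing bond: `‖V(c)·U₀(c)⁻¹ − 1‖ = ‖V′(b₀) − 1‖` (conjugation isometry). [folklore] -/
theorem norm_corner_contour_sub_one [NormOneClass R] {L : ℕ} {y : Site d} {μ : Fin d} {U₀ V : Cfg d R} (hL : 1 ≤ L)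
    (hU₀ : ∀ x ν, UnitaryLike (U₀ x ν)) (hT : TreeRel L y U₀ V) :
    ‖((hol V y (Pi.single μ L) * (hol U₀ y (Pi.single μ L))⁻¹ : Rˣ) : R) - 1‖ =
      ‖(pert U₀ V (site y (Pi.single μ (L - 1))) μ : R) - 1‖ := by
  rw [corner_contour hL hT, Units.val_mul, Units.val_mul, norm_conj_sub_one_eq (unitaryLike_hol hU₀ y _)]

/-! ## §6  Assembly on `B(c₋) ∪ B(c₊)`: every bond, up to the one number `X_c = ‖V(c)U₀(c)⁻¹ − 1‖` -/

/-- [cite: Balaban1985RegularSpaces, (1.23) p. 79] RECOGNISING A CROSSING BOND: if `x ∈ B(c₋)` and `x + e_ν ∈ B(c₊)` then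
`ν = μ` and `x = x_t` for a transverse position `t` (the case analysis of `B8Lemma1Lattice.lemma1_lattice`). [folklore] -/
theorem crossing_of_inPair {L : ℕ} {y : Site d} {μ : Fin d} {x : Site d} {ν : Fin d} (hx : InBlock L y x)
    (hxν : InBlock L (yplus L y μ) (x + e ν)) : ν = μ ∧ ∃ t : Trans d L μ, x = crossSite L y μ t := by
  obtain ⟨k, hk, rfl⟩ := exists_offset_of_inBlock hx
  have hνμ : ν = μ := by
    by_contra hνμ
    have h1 := (hxν μ).1
    simp only [yplus, site, e, Pi.add_apply, Pi.single_eq_same, Pi.single_eq_of_ne (Ne.symm hνμ)] at h1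
    have := hk μ
    omega
  subst hνμ
  have hkν : k ν = L - 1 := by
    have h1 := (hxν ν).1
    simp only [yplus, site, e, Pi.add_apply, Pi.single_eq_same] at h1
    have := hk ν
    omega
  refine ⟨rfl, fun κ => ⟨k κ.1, hk κ.1⟩, ?_⟩
  rw [crossSite]; congr 1
  funext κ
  by_cases hκ : κ = ν
  · subst hκ; rw [offset_apply_mu, hkν]
  · rw [offset_apply_ne ν _ _ hκ]

/-- [folklore] Both ends of a bond of the region lie in the same block, or the bond crosses from `B(c₋)` to `B(c₊)`. -/
theorem inPair_cases {L : ℕ} {y : Site d} {μ : Fin d} {x : Site d} {ν : Fin d} (hx : InPair L y μ x)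
    (hxν : InPair L y μ (x + e ν)) :
    (InBlock L y x ∧ InBlock L y (x + e ν)) ∨ (InBlock L (yplus L y μ) x ∧ InBlock L (yplus L y μ) (x + e ν)) ∨
      (InBlock L y x ∧ InBlock L (yplus L y μ) (x + e ν)) := by
  rcases hx with hx | hx <;> rcases hxν with hxν | hxν
  · exact Or.inl ⟨hx, hxν⟩
  · exact Or.inr (Or.inr ⟨hx, hxν⟩)
  · exact (not_right_left hx hxν).elim
  · exact Or.inr (Or.inl ⟨hx, hxν⟩)

/-- [folklore] The assembled constant `C(d, L) = (d−1)(L−1)·(1 + 2(d−1)(L−1))`: `(d−1)(L−1)` steps of size `(q_V + q₀) +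
2·(d−1)(L−1)(q_V + q₀)`; it dominates the interior constant `(d−1)(L−1)`. -/
def crossConst (d L : ℕ) : ℝ := ((d : ℝ) - 1) * ((L : ℝ) - 1) * (1 + 2 * (((d : ℝ) - 1) * ((L : ℝ) - 1)))

/-- [folklore] `0 ≤ (d−1)(L−1)` for `d, L ≥ 1`. -/
theorem interiorConst_nonneg {d L : ℕ} (hd : 1 ≤ d) (hL : 1 ≤ L) : 0 ≤ ((d : ℝ) - 1) * ((L : ℝ) - 1) := by
  have h1 : (1 : ℝ) ≤ d := by exact_mod_cast hd
  have h2 : (1 : ℝ) ≤ L := by exact_mod_cast hL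
  exact mul_nonneg (by linarith) (by linarith)

/-- [folklore] `(d−1)(L−1) ≤ C(d, L)`. -/
theorem interiorConst_le_crossConst {d L : ℕ} (hd : 1 ≤ d) (hL : 1 ≤ L) :
    ((d : ℝ) - 1) * ((L : ℝ) - 1) ≤ crossConst d L := by
  have h := interiorConst_nonneg hd hL
  unfold crossConst
  nlinarith

/-- [cite: Balaban1985RegularSpaces, Lemma 1 pp. 79–80] **THE TWO-BLOCK BOUND, NON-ABELIAN, for given gauge-fixed data**:
for a unitary-like pair `(U₀, V)` in relative axial gauge on both `B(c₋)` and `B(c₊)`, with curvature sups `q_V`, `q₀` on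
the plaquettes of `B(c₋) ∪ B(c₊)`, EVERY bond with both ends in `B(c₋) ∪ B(c₊)` satisfies `‖V′ − 1‖ ≤ C(d,L)·(q_V + q₀)
+ X_c`, `X_c = ‖V′(b₀) − 1‖ = ‖V(c)U₀(c)⁻¹ − 1‖` (`norm_corner_contour_sub_one`) — the printed chain up to, and excluding,
the average sentence that bounds `X_c` by `α₁`. [folklore] -/
theorem two_block_bound [NormOneClass R] {U₀ V : Cfg d R} {L : ℕ} {y : Site d} {μ : Fin d} {qV q₀ : ℝ}
    (hU₀ : ∀ x ν, UnitaryLike (U₀ x ν)) (hV : ∀ x ν, UnitaryLike (V x ν)) (hL : 1 ≤ L)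
    (hTm : TreeRel L y U₀ V) (hTp : TreeRel L (yplus L y μ) U₀ V)
    (hqV : PlaqSupPair L y μ (fun x ρ ν => ‖(plaq V x ρ ν : R) - 1‖) qV)
    (hq₀ : PlaqSupPair L y μ (fun x ρ ν => ‖(plaq U₀ x ρ ν : R) - 1‖) q₀) (hq : 0 ≤ qV + q₀)
    (x : Site d) (ν : Fin d) (hx : InPair L y μ x) (hxν : InPair L y μ (x + e ν)) :
    ‖(pert U₀ V x ν : R) - 1‖ ≤
      crossConst d L * (qV + q₀) + ‖(pert U₀ V (site y (Pi.single μ (L - 1))) μ : R) - 1‖ := by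
  have hd : 1 ≤ d := by have := μ.isLt; omega
  have hN := interiorConst_nonneg hd hL
  have hX := norm_nonneg ((pert U₀ V (site y (Pi.single μ (L - 1))) μ : R) - 1)
  have hCI := mul_le_mul_of_nonneg_right (interiorConst_le_crossConst hd hL) hq
  have hIm : ∀ x ν, InBlock L y x → InBlock L y (x + e ν) →
      ‖(pert U₀ V x ν : R) - 1‖ ≤ ((d : ℝ) - 1) * ((L : ℝ) - 1) * (qV + q₀) :=
    interior_bound_of_treeRel hU₀ hV hTm (plaqSupPair_left hqV) (plaqSupPair_left hq₀) hq
  have hIp : ∀ x ν, InBlock L (yplus L y μ) x → InBlock L (yplus L y μ) (x + e ν) →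
      ‖(pert U₀ V x ν : R) - 1‖ ≤ ((d : ℝ) - 1) * ((L : ℝ) - 1) * (qV + q₀) :=
    interior_bound_of_treeRel hU₀ hV hTp (plaqSupPair_right hqV) (plaqSupPair_right hq₀) hq
  rcases inPair_cases hx hxν with ⟨h1, h2⟩ | ⟨h1, h2⟩ | ⟨h1, h2⟩
  · exact (hIm x ν h1 h2).trans (by linarith)
  · exact (hIp x ν h1 h2).trans (by linarith)
  · obtain ⟨rfl, t, rfl⟩ := crossing_of_inPair h1 h2
    have hs : 0 ≤ qV + q₀ + ((d : ℝ) - 1) * ((L : ℝ) - 1) * (qV + q₀) + ((d : ℝ) - 1) * ((L : ℝ) - 1) * (qV + q₀) := by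
      positivity
    have h := norm_cross_sub_one_le hU₀ hV hL hqV hq₀ hIm hIp hs t (tzero ν hL)
    rw [crossSite_tzero] at h
    refine h.trans ?_
    rw [add_comm]
    refine add_le_add_left (le_of_eq ?_) _
    unfold crossConst; ring

/-! ### The comb form: an ARBITRARY configuration `U₁`, gauge-fixed block-wise (record (O2b) "block-wise combs, patched") -/

/-- [folklore] THE PATCHED GAUGE of two neighbouring blocks: the relative comb gauge of `B(c₋)` on `B(c₋)`, that of `B(c₊)`
everywhere else (in particular on `B(c₊)`; the two blocks are disjoint, `not_right_left`). -/
noncomputable def patchGauge (L : ℕ) (y : Site d) (μ : Fin d) (U₀ U₁ : Cfg d R) : Site d → Rˣ := fun x =>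
  by classical exact if InBlock L y x then combGauge U₀ U₁ y x else combGauge U₀ U₁ (yplus L y μ) x

/-- [folklore] The patched gauge is unitary-like. -/
theorem unitaryLike_patchGauge [NormOneClass R] {U₀ U₁ : Cfg d R} (hU₀ : ∀ x ν, UnitaryLike (U₀ x ν))
    (hU₁ : ∀ x ν, UnitaryLike (U₁ x ν)) (L : ℕ) (y : Site d) (μ : Fin d) (x : Site d) :
    UnitaryLike (patchGauge L y μ U₀ U₁ x) := by
  unfold patchGauge
  split_ifs
  · exact unitaryLike_combGauge hU₀ hU₁ _ _
  · exact unitaryLike_combGauge hU₀ hU₁ _ _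

/-- [folklore] On `B(c₋)` the patched gauge is the comb gauge of `B(c₋)`. -/
theorem patchGauge_of_left {L : ℕ} {y : Site d} {μ : Fin d} (U₀ U₁ : Cfg d R) {x : Site d} (hx : InBlock L y x) :
    patchGauge L y μ U₀ U₁ x = combGauge U₀ U₁ y x := by
  unfold patchGauge; rw [if_pos hx]

/-- [folklore] On `B(c₊)` the patched gauge is the comb gauge of `B(c₊)`. -/
theorem patchGauge_of_right {L : ℕ} {y : Site d} {μ : Fin d} (U₀ U₁ : Cfg d R) {x : Site d}
    (hx : InBlock L (yplus L y μ) x) : patchGauge L y μ U₀ U₁ x = combGauge U₀ U₁ (yplus L y μ) x := by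
  have hx' : ¬ InBlock L y x := by
    intro h
    have h1 := (hx μ).1
    have h2 := (h μ).2
    simp only [yplus, site, Pi.single_eq_same] at h1
    omega
  unfold patchGauge; rw [if_neg hx']

/-- [folklore] A bond with both ends in `B(c₋)` is gauge-transformed by the comb gauge of `B(c₋)`. -/
theorem gaugeAct_patch_left {L : ℕ} {y : Site d} {μ : Fin d} (U₀ U₁ : Cfg d R) {x : Site d} {ν : Fin d}
    (hx : InBlock L y x) (hxν : InBlock L y (x + e ν)) :
    gaugeAct (patchGauge L y μ U₀ U₁) U₁ x ν = gaugeAct (combGauge U₀ U₁ y) U₁ x ν := by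
  simp only [gaugeAct, patchGauge_of_left U₀ U₁ hx, patchGauge_of_left U₀ U₁ hxν]

/-- [folklore] A bond with both ends in `B(c₊)` is gauge-transformed by the comb gauge of `B(c₊)`. -/
theorem gaugeAct_patch_right {L : ℕ} {y : Site d} {μ : Fin d} (U₀ U₁ : Cfg d R) {x : Site d} {ν : Fin d}
    (hx : InBlock L (yplus L y μ) x) (hxν : InBlock L (yplus L y μ) (x + e ν)) :
    gaugeAct (patchGauge L y μ U₀ U₁) U₁ x ν = gaugeAct (combGauge U₀ U₁ (yplus L y μ)) U₁ x ν := by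
  simp only [gaugeAct, patchGauge_of_right U₀ U₁ hx, patchGauge_of_right U₀ U₁ hxν]

/-- [folklore] `(U₀, U₁^g)` is in relative axial gauge on `B(c₋)`. -/
theorem treeRel_patch_left (L : ℕ) (y : Site d) (μ : Fin d) (U₀ U₁ : Cfg d R) :
    TreeRel L y U₀ (gaugeAct (patchGauge L y μ U₀ U₁) U₁) := by
  intro k ρ hk hρ ht
  have h1 : InBlock L y (site y k) := (inBlock_site_iff L y k).2 hk
  have h2 : InBlock L y (site y k + e ρ) := by
    rw [← site_add_single]; exact (inBlock_site_iff L y _).2 (lt_of_add_single hk hρ)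
  rw [gaugeAct_patch_left U₀ U₁ h1 h2]
  exact gaugeAct_combGauge_tree U₀ U₁ y ht

/-- [folklore] `(U₀, U₁^g)` is in relative axial gauge on `B(c₊)`. -/
theorem treeRel_patch_right (L : ℕ) (y : Site d) (μ : Fin d) (U₀ U₁ : Cfg d R) :
    TreeRel L (yplus L y μ) U₀ (gaugeAct (patchGauge L y μ U₀ U₁) U₁) := by
  intro k ρ hk hρ ht
  have h1 : InBlock L (yplus L y μ) (site (yplus L y μ) k) := (inBlock_site_iff L _ k).2 hk
  have h2 : InBlock L (yplus L y μ) (site (yplus L y μ) k + e ρ) := by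
    rw [← site_add_single]; exact (inBlock_site_iff L _ _).2 (lt_of_add_single hk hρ)
  rw [gaugeAct_patch_right U₀ U₁ h1 h2]
  exact gaugeAct_combGauge_tree U₀ U₁ _ ht

/-- [folklore] Curvature is gauge invariant in norm: a curvature sup of `U₁` on the region is one of `U₁^g`. -/
theorem plaqSupPair_gaugeAct [NormOneClass R] {L : ℕ} {y : Site d} {μ : Fin d} {g : Site d → Rˣ} {U₁ : Cfg d R} {q : ℝ}
    (hg : ∀ x, UnitaryLike (g x)) (hq : PlaqSupPair L y μ (fun x ρ ν => ‖(plaq U₁ x ρ ν : R) - 1‖) q) :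
    PlaqSupPair L y μ (fun x ρ ν => ‖(plaq (gaugeAct g U₁) x ρ ν : R) - 1‖) q := by
  intro x ρ ν hρν h1 h2 h3 h4
  show ‖(plaq (gaugeAct g U₁) x ρ ν : R) - 1‖ ≤ q
  rw [plaq_gaugeAct, Units.val_mul, Units.val_mul, norm_conj_sub_one_eq (hg x)]
  exact hq x ρ ν hρν h1 h2 h3 h4

/-- [cite: Balaban1985RegularSpaces, Lemma 1 pp. 79–80] **THE TWO-BLOCK BOUND IN THE PATCHED COMB GAUGE**: for ANY unitary-like
pair `(U₀, U₁)` with curvature sups `q₁, q₀` on the plaquettes of `B(c₋) ∪ B(c₊)`, the block-wise gauge-fixed `V = U₁^g`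
(`g = patchGauge`) satisfies `‖(U₁^g)U₀⁻¹ − 1‖ ≤ C(d,L)·(q₁ + q₀) + X_c` on every bond with both ends in `B(c₋) ∪ B(c₊)`,
`X_c = ‖(U₁^g)(b₀)U₀(b₀)⁻¹ − 1‖` the corner crossing defect — two blocks of record (O2b), sup norm. [folklore] -/
theorem two_block_bound_comb [NormOneClass R] {U₀ U₁ : Cfg d R} {L : ℕ} {y : Site d} {μ : Fin d} {q₁ q₀ : ℝ}
    (hU₀ : ∀ x ν, UnitaryLike (U₀ x ν)) (hU₁ : ∀ x ν, UnitaryLike (U₁ x ν)) (hL : 1 ≤ L)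
    (hq₁ : PlaqSupPair L y μ (fun x ρ ν => ‖(plaq U₁ x ρ ν : R) - 1‖) q₁)
    (hq₀ : PlaqSupPair L y μ (fun x ρ ν => ‖(plaq U₀ x ρ ν : R) - 1‖) q₀) (hq : 0 ≤ q₁ + q₀)
    (x : Site d) (ν : Fin d) (hx : InPair L y μ x) (hxν : InPair L y μ (x + e ν)) :
    ‖(pert U₀ (gaugeAct (patchGauge L y μ U₀ U₁) U₁) x ν : R) - 1‖ ≤
      crossConst d L * (q₁ + q₀) +
        ‖(pert U₀ (gaugeAct (patchGauge L y μ U₀ U₁) U₁) (site y (Pi.single μ (L - 1))) μ : R) - 1‖ :=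
  have hg := unitaryLike_patchGauge hU₀ hU₁ L y μ
  two_block_bound hU₀ (unitaryLike_gaugeAct hg hU₁) hL (treeRel_patch_left L y μ U₀ U₁)
    (treeRel_patch_right L y μ U₀ U₁) (plaqSupPair_gaugeAct hg hq₁) hq₀ hq x ν hx hxν

/-! ## §7  The contours `Γ_{c,x}` of the block average (42): every contour ratio is a conjugate of `V′(b₀)` -/

/-- [cite: Balaban1985Averaging, (42) p. 23 and p. 19] THE RATIO of the straight-segment holonomies `V([x, x + n e_μ])·
U₀([x, x + n e_μ])⁻¹` (`hol · x (n e_μ)` is the straight segment, `hol_single_succ`). [folklore] -/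
def segRatio (U₀ V : Cfg d R) (x : Site d) (μ : Fin d) (n : ℕ) : Rˣ :=
  hol V x (Pi.single μ n) * (hol U₀ x (Pi.single μ n))⁻¹

/-- [folklore] The empty segment. -/
theorem segRatio_zero (U₀ V : Cfg d R) (x : Site d) (μ : Fin d) : segRatio U₀ V x μ 0 = 1 := by
  simp [segRatio, Pi.single_zero, hol_zero]

/-- [folklore] THE SEGMENT RATIO RECURSION: one more bond multiplies the ratio by the TRANSPORTED defect
`Ad_{U₀([x, x + n e_μ])}(V′⟨x + n e_μ, ·+e_μ⟩)` — the ratio is the ordered product of the transported `V′` of the segment. -/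
theorem segRatio_succ (U₀ V : Cfg d R) (x : Site d) (μ : Fin d) (n : ℕ) :
    segRatio U₀ V x μ (n + 1) = segRatio U₀ V x μ n *
      (hol U₀ x (Pi.single μ n) * pert U₀ V (site x (Pi.single μ n)) μ * (hol U₀ x (Pi.single μ n))⁻¹) := by
  simp only [segRatio, hol_single_succ, pert]
  group

/-- [folklore] The segment ratio of a unitary-like pair is unitary-like. -/
theorem unitaryLike_segRatio [NormOneClass R] {U₀ V : Cfg d R} (hU₀ : ∀ x ν, UnitaryLike (U₀ x ν))
    (hV : ∀ x ν, UnitaryLike (V x ν)) (x : Site d) (μ : Fin d) (n : ℕ) : UnitaryLike (segRatio U₀ V x μ n) :=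
  (unitaryLike_hol hV x _).mul (unitaryLike_hol hU₀ x _).inv

/-- [cite: Balaban1985Averaging, p. 25 "|V₀(Γ_{c,x}) − 1| ≦ Σ_{b⊂Γ_{c,x}} |V₀,b − 1|"] The plain chain for the ratio: if the
first `n` bonds of the segment have `‖V′ − 1‖ ≤ I` then `‖segRatio n − 1‖ ≤ n·I` (conjugation isometry per factor).
[folklore] -/
theorem norm_segRatio_sub_one_le [NormOneClass R] {U₀ V : Cfg d R} (hU₀ : ∀ x ν, UnitaryLike (U₀ x ν))
    (hV : ∀ x ν, UnitaryLike (V x ν)) (x : Site d) (μ : Fin d) {I : ℝ} :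
    ∀ n : ℕ, (∀ j < n, ‖(pert U₀ V (site x (Pi.single μ j)) μ : R) - 1‖ ≤ I) →
      ‖(segRatio U₀ V x μ n : R) - 1‖ ≤ (n : ℝ) * I
  | 0, _ => by simp [segRatio_zero]
  | n + 1, h => by
      have hA : UnitaryLike (hol U₀ x (Pi.single μ n) * pert U₀ V (site x (Pi.single μ n)) μ *
          (hol U₀ x (Pi.single μ n))⁻¹) :=
        ((unitaryLike_hol hU₀ x _).mul (unitaryLike_pert hU₀ hV _ _)).mul (unitaryLike_hol hU₀ x _).inv
      have hAn : ‖((hol U₀ x (Pi.single μ n) * pert U₀ V (site x (Pi.single μ n)) μ *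
          (hol U₀ x (Pi.single μ n))⁻¹ : Rˣ) : R) - 1‖ ≤ I := by
        rw [Units.val_mul, Units.val_mul, norm_conj_sub_one_eq (unitaryLike_hol hU₀ x _)]
        exact h n (Nat.lt_succ_self n)
      have ih := norm_segRatio_sub_one_le hU₀ hV x μ n (fun j hj => h j (Nat.lt_succ_of_lt hj))
      rw [segRatio_succ, Units.val_mul]
      calc _ ≤ ‖(segRatio U₀ V x μ n : R) - 1‖ + ‖((hol U₀ x (Pi.single μ n) * pert U₀ V (site x (Pi.single μ n)) μ *
              (hol U₀ x (Pi.single μ n))⁻¹ : Rˣ) : R) - 1‖ := T4AxialChain.norm_mul_sub_one_le_add' _ hA.1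
        _ ≤ (n : ℝ) * I + I := add_le_add ih hAn
        _ = ((n + 1 : ℕ) : ℝ) * I := by push_cast; ring

/-- [cite: Balaban1985RegularSpaces, Lemma 1 proof pp. 79–80 "4(d−1)(L−1)Lα₀L⁻²"] THE CHAIN WITH ONE FREE FACTOR: if every bond
of the segment `[x, x + (j₀+1+m) e_μ]` EXCEPT the `j₀`-th has `‖V′ − 1‖ ≤ I`, the ratio is within `(j₀ + m)·I` of the
transported free factor `Ad_{U₀([x, x + j₀e_μ])}(V′⟨x + j₀e_μ, ·⟩)` — `R·A − T = (R − T)·A + T·(A − 1)`. [folklore] -/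
theorem norm_segRatio_sub_conj_le [NormOneClass R] {U₀ V : Cfg d R} (hU₀ : ∀ x ν, UnitaryLike (U₀ x ν))
    (hV : ∀ x ν, UnitaryLike (V x ν)) (x : Site d) (μ : Fin d) {I : ℝ} (j₀ : ℕ)
    (hlo : ∀ j < j₀, ‖(pert U₀ V (site x (Pi.single μ j)) μ : R) - 1‖ ≤ I) :
    ∀ m : ℕ, (∀ j, j₀ < j → j < j₀ + 1 + m → ‖(pert U₀ V (site x (Pi.single μ j)) μ : R) - 1‖ ≤ I) →
      ‖(segRatio U₀ V x μ (j₀ + 1 + m) : R) -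
          ((hol U₀ x (Pi.single μ j₀) * pert U₀ V (site x (Pi.single μ j₀)) μ * (hol U₀ x (Pi.single μ j₀))⁻¹ : Rˣ) : R)‖
        ≤ ((j₀ : ℝ) + m) * I
  | 0, _ => by
      have hT : UnitaryLike (hol U₀ x (Pi.single μ j₀) * pert U₀ V (site x (Pi.single μ j₀)) μ *
          (hol U₀ x (Pi.single μ j₀))⁻¹) :=
        ((unitaryLike_hol hU₀ x _).mul (unitaryLike_pert hU₀ hV _ _)).mul (unitaryLike_hol hU₀ x _).inv
      rw [Nat.add_zero, segRatio_succ, Units.val_mul]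
      have e1 : ∀ r T : R, r * T - T = (r - 1) * T := fun r T => by noncomm_ring
      rw [e1, Nat.cast_zero, add_zero]
      exact (norm_mul_unit_le hT _).trans (norm_segRatio_sub_one_le hU₀ hV x μ j₀ hlo)
  | m + 1, h => by
      have hT : UnitaryLike (hol U₀ x (Pi.single μ j₀) * pert U₀ V (site x (Pi.single μ j₀)) μ *
          (hol U₀ x (Pi.single μ j₀))⁻¹) :=
        ((unitaryLike_hol hU₀ x _).mul (unitaryLike_pert hU₀ hV _ _)).mul (unitaryLike_hol hU₀ x _).inv
      have hA : UnitaryLike (hol U₀ x (Pi.single μ (j₀ + 1 + m)) * pert U₀ V (site x (Pi.single μ (j₀ + 1 + m))) μ *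
          (hol U₀ x (Pi.single μ (j₀ + 1 + m)))⁻¹) :=
        ((unitaryLike_hol hU₀ x _).mul (unitaryLike_pert hU₀ hV _ _)).mul (unitaryLike_hol hU₀ x _).inv
      have hAn : ‖((hol U₀ x (Pi.single μ (j₀ + 1 + m)) * pert U₀ V (site x (Pi.single μ (j₀ + 1 + m))) μ *
          (hol U₀ x (Pi.single μ (j₀ + 1 + m)))⁻¹ : Rˣ) : R) - 1‖ ≤ I := by
        rw [Units.val_mul, Units.val_mul, norm_conj_sub_one_eq (unitaryLike_hol hU₀ x _)]
        exact h _ (by omega) (by omega)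
      have ih := norm_segRatio_sub_conj_le hU₀ hV x μ j₀ hlo m (fun j hj hj' => h j hj (by omega))
      rw [show j₀ + 1 + (m + 1) = (j₀ + 1 + m) + 1 by ring, segRatio_succ, Units.val_mul]
      have e1 : ∀ r A T : R, r * A - T = (r - T) * A + T * (A - 1) := fun r A T => by noncomm_ring
      rw [e1]
      calc _ ≤ ‖((segRatio U₀ V x μ (j₀ + 1 + m) : R) - ((hol U₀ x (Pi.single μ j₀) *
                pert U₀ V (site x (Pi.single μ j₀)) μ * (hol U₀ x (Pi.single μ j₀))⁻¹ : Rˣ) : R)) *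
                ((hol U₀ x (Pi.single μ (j₀ + 1 + m)) * pert U₀ V (site x (Pi.single μ (j₀ + 1 + m))) μ *
                  (hol U₀ x (Pi.single μ (j₀ + 1 + m)))⁻¹ : Rˣ) : R)‖
              + ‖((hol U₀ x (Pi.single μ j₀) * pert U₀ V (site x (Pi.single μ j₀)) μ *
                  (hol U₀ x (Pi.single μ j₀))⁻¹ : Rˣ) : R) *
                (((hol U₀ x (Pi.single μ (j₀ + 1 + m)) * pert U₀ V (site x (Pi.single μ (j₀ + 1 + m))) μ *
                  (hol U₀ x (Pi.single μ (j₀ + 1 + m)))⁻¹ : Rˣ) : R) - 1)‖ := norm_add_le _ _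
        _ ≤ ((j₀ : ℝ) + m) * I + I := add_le_add ((norm_mul_unit_le hA _).trans ih) ((norm_unit_mul_le hT _).trans hAn)
        _ = ((j₀ : ℝ) + ((m + 1 : ℕ) : ℝ)) * I := by push_cast; ring

/-- [cite: Balaban1985Averaging, p. 19 "Γ_{c,x} = Γ_{c₋,x} ∪ [x, x(c)] ∪ Γ_{x(c),c₊}"] THE CONTOUR `Γ_{c,x}` of the average
(42) for `x = y + k ∈ B(c₋)`: the tree path of `B(c₋)` from `c₋ = y` to `x`, the straight segment `[x, x + Le_μ]`, and the
tree path of `B(c₊)` from `x(c) = x + Le_μ = (y + Le_μ) + k` back to `c₊ = y + Le_μ` (reversed). [folklore] -/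
def contourHol (U : Cfg d R) (L : ℕ) (y : Site d) (μ : Fin d) (k : Fin d → ℕ) : Rˣ :=
  hol U y k * hol U (site y k) (Pi.single μ L) * (hol U (yplus L y μ) k)⁻¹

/-- [cite: Balaban1985Averaging, (42) p. 23] "U(c)": the contour of the corner `x = c₋` is the straight coarse bond,
`contourHol U L y μ 0 = hol U y (Le_μ)`. [folklore] -/
theorem contourHol_zero (U : Cfg d R) (L : ℕ) (y : Site d) (μ : Fin d) :
    contourHol U L y μ 0 = hol U y (Pi.single μ L) := by
  have h0 : site y (0 : Fin d → ℕ) = y := by funext κ; simp [site]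
  simp [contourHol, hol_zero, h0]

/-- [folklore] THE CONTOUR RATIO IN RELATIVE AXIAL GAUGE: the two tree paths carry equal holonomies for `V` and `U₀`
(`hol_congr_of_treeRel` on both blocks), so `V(Γ_{c,x})·U₀(Γ_{c,x})⁻¹ = U₀(Γ_{y,x}) · segRatio(L) · U₀(Γ_{y,x})⁻¹`. -/
theorem contour_ratio_eq {L : ℕ} {y : Site d} {μ : Fin d} {U₀ V : Cfg d R} (hTm : TreeRel L y U₀ V)
    (hTp : TreeRel L (yplus L y μ) U₀ V) (k : Fin d → ℕ) (hk : ∀ κ, k κ < L) :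
    contourHol V L y μ k * (contourHol U₀ L y μ k)⁻¹ =
      hol U₀ y k * segRatio U₀ V (site y k) μ L * (hol U₀ y k)⁻¹ := by
  simp only [contourHol, segRatio, hol_congr_of_treeRel hTm k hk, hol_congr_of_treeRel hTp k hk]
  group

/-- [folklore] Every site of `B(c₋)` is `y + t + h₀e_μ` for a transverse position `t` and a height `h₀ < L`. -/
theorem exists_trans_of_inBlock {L : ℕ} {y : Site d} (μ : Fin d) {x : Site d} (hx : InBlock L y x) :
    ∃ (t : Trans d L μ) (h₀ : ℕ), h₀ < L ∧ x = site y (offset μ t h₀) := by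
  obtain ⟨k, hk, rfl⟩ := exists_offset_of_inBlock hx
  refine ⟨fun κ => ⟨k κ.1, hk κ.1⟩, k μ, hk μ, ?_⟩
  congr 1; funext κ
  by_cases hκ : κ = μ
  · subst hκ; rw [offset_apply_mu]
  · rw [offset_apply_ne μ _ _ hκ]

/-- [cite: Balaban1985RegularSpaces, Lemma 1 proof pp. 79–80; Balaban1985Averaging, (42)] **EVERY CONTOUR RATIO IS A CONJUGATE
OF ITS CROSSING BOND up to `(L−1)·I`**: for `x = y + t + h₀e_μ ∈ B(c₋)` the segment `[x, x + Le_μ]` consists of `L − 1 − h₀`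
interior bonds of `B(c₋)`, the crossing bond `b_t`, and `h₀` interior bonds of `B(c₊)`, so with interior bounds `I` on both
blocks `‖V(Γ_{c,x})U₀(Γ_{c,x})⁻¹ − Q·V′(b_t)·Q⁻¹‖ ≤ (L−1)·I` for a unitary-like `Q` (the abelian `segment_split` +
`abs_interiorPart_le` of `B8Lemma1Lattice`, non-abelian). [folklore] -/
theorem contour_ratio_conj [NormOneClass R] {U₀ V : Cfg d R} {L : ℕ} {y : Site d} {μ : Fin d} {I : ℝ}
    (hU₀ : ∀ x ν, UnitaryLike (U₀ x ν)) (hV : ∀ x ν, UnitaryLike (V x ν))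
    (hTm : TreeRel L y U₀ V) (hTp : TreeRel L (yplus L y μ) U₀ V)
    (hIm : ∀ x ν, InBlock L y x → InBlock L y (x + e ν) → ‖(pert U₀ V x ν : R) - 1‖ ≤ I)
    (hIp : ∀ x ν, InBlock L (yplus L y μ) x → InBlock L (yplus L y μ) (x + e ν) → ‖(pert U₀ V x ν : R) - 1‖ ≤ I)
    (t : Trans d L μ) {h₀ : ℕ} (hh₀ : h₀ < L) :
    ∃ Q : Rˣ, UnitaryLike Q ∧
      ‖((contourHol V L y μ (offset μ t h₀) * (contourHol U₀ L y μ (offset μ t h₀))⁻¹ : Rˣ) : R) -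
          ((Q * pert U₀ V (crossSite L y μ t) μ * Q⁻¹ : Rˣ) : R)‖ ≤ ((L : ℝ) - 1) * I := by
  have hk : ∀ κ, offset μ t h₀ κ < L := offset_lt μ t hh₀
  -- the bonds of the segment, by height
  have hseg : ∀ j, site (site y (offset μ t h₀)) (Pi.single μ j) = site y (offset μ t (h₀ + j)) := fun j => by
    rw [site_site, offset_add_single]
  have hlo : ∀ j < L - 1 - h₀, ‖(pert U₀ V (site (site y (offset μ t h₀)) (Pi.single μ j)) μ : R) - 1‖ ≤ I := by
    intro j hj
    rw [hseg]
    refine hIm _ μ ((inBlock_site_iff L y _).2 (offset_lt μ t (by omega))) ?_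
    rw [← site_add_single, offset_add_single]
    exact (inBlock_site_iff L y _).2 (offset_lt μ t (by omega))
  have hhi : ∀ j, L - 1 - h₀ < j → j < L - 1 - h₀ + 1 + h₀ →
      ‖(pert U₀ V (site (site y (offset μ t h₀)) (Pi.single μ j)) μ : R) - 1‖ ≤ I := by
    intro j hj hj'
    rw [hseg, show h₀ + j = (h₀ + j - L) + L by omega, site_offset_add]
    refine hIp _ μ ((inBlock_site_iff L _ _).2 (offset_lt μ t (by omega))) ?_
    rw [← site_add_single, offset_add_single]
    exact (inBlock_site_iff L _ _).2 (offset_lt μ t (by omega))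
  have hmid : site (site y (offset μ t h₀)) (Pi.single μ (L - 1 - h₀)) = crossSite L y μ t := by
    rw [hseg, crossSite, show h₀ + (L - 1 - h₀) = L - 1 by omega]
  have h := norm_segRatio_sub_conj_le hU₀ hV (site y (offset μ t h₀)) μ (L - 1 - h₀) hlo h₀ hhi
  rw [hmid, show L - 1 - h₀ + 1 + h₀ = L by omega] at h
  refine ⟨hol U₀ y (offset μ t h₀) * hol U₀ (site y (offset μ t h₀)) (Pi.single μ (L - 1 - h₀)),
    (unitaryLike_hol hU₀ y _).mul (unitaryLike_hol hU₀ _ _), ?_⟩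
  rw [contour_ratio_eq hTm hTp _ hk]
  have e1 : ∀ A S W : Rˣ, (A * S) * W * (A * S)⁻¹ = A * (S * W * S⁻¹) * A⁻¹ := fun A S W => by group
  rw [e1, Units.val_mul, Units.val_mul, Units.val_mul (hol U₀ y (offset μ t h₀) * _), Units.val_mul (hol U₀ y _)]
  refine (norm_conj_sub_conj_le (unitaryLike_hol hU₀ y _) _ _).trans (h.trans (le_of_eq ?_))
  have h1 : ((L - 1 - h₀ : ℕ) : ℝ) + (h₀ : ℝ) = (L : ℝ) - 1 := by
    rw [Nat.cast_sub (by omega), Nat.cast_sub (by omega), Nat.cast_one]; ring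
  rw [h1]

/-- [cite: Balaban1985RegularSpaces, Lemma 1 proof pp. 79–80] **ALL `L^d` CONTOUR RATIOS ARE CONJUGATES OF THE COARSE-BOND RATIO**
`w_c = V(c)·U₀(c)⁻¹` (= the contour ratio of the corner, `contourHol_zero`) up to `ρ = (L−1)·I + (d−1)(L−1)·(q_V + q₀ + 2I)`:
`‖V(Γ_{c,x})U₀(Γ_{c,x})⁻¹ − Q·w_c·Q⁻¹‖ ≤ ρ` for every `x ∈ B(c₋)` (`contour_ratio_conj` + `cross_any` + `corner_contour`).
What the average sentence of the proof must invert is exactly this: a bound `α₁` on the distance of the (42)-averages of `V`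
and `U₀` against `L^d` inputs each `ρ`-close to a conjugate of the one element `w_c` (HONEST SCOPE (i)). [folklore] -/
theorem contour_ratio_near_coarse [NormOneClass R] {U₀ V : Cfg d R} {L : ℕ} {y : Site d} {μ : Fin d} {qV q₀ I : ℝ}
    (hU₀ : ∀ x ν, UnitaryLike (U₀ x ν)) (hV : ∀ x ν, UnitaryLike (V x ν)) (hL : 1 ≤ L)
    (hTm : TreeRel L y U₀ V) (hTp : TreeRel L (yplus L y μ) U₀ V)
    (hqV : PlaqSupPair L y μ (fun x ρ ν => ‖(plaq V x ρ ν : R) - 1‖) qV)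
    (hq₀ : PlaqSupPair L y μ (fun x ρ ν => ‖(plaq U₀ x ρ ν : R) - 1‖) q₀)
    (hIm : ∀ x ν, InBlock L y x → InBlock L y (x + e ν) → ‖(pert U₀ V x ν : R) - 1‖ ≤ I)
    (hIp : ∀ x ν, InBlock L (yplus L y μ) x → InBlock L (yplus L y μ) (x + e ν) → ‖(pert U₀ V x ν : R) - 1‖ ≤ I)
    (hs : 0 ≤ qV + q₀ + I + I) {x : Site d} (hx : InBlock L y x) :
    ∃ (k : Fin d → ℕ) (Q : Rˣ), x = site y k ∧ UnitaryLike Q ∧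
      ‖((contourHol V L y μ k * (contourHol U₀ L y μ k)⁻¹ : Rˣ) : R) -
          ((Q * (hol V y (Pi.single μ L) * (hol U₀ y (Pi.single μ L))⁻¹) * Q⁻¹ : Rˣ) : R)‖
        ≤ ((L : ℝ) - 1) * I + ((d : ℝ) - 1) * ((L : ℝ) - 1) * (qV + q₀ + I + I) := by
  obtain ⟨t, h₀, hh₀, rfl⟩ := exists_trans_of_inBlock μ hx
  obtain ⟨Q, hQ, h1⟩ := contour_ratio_conj hU₀ hV hTm hTp hIm hIp t hh₀
  obtain ⟨P, hP, h2⟩ := cross_any hU₀ hV hL hqV hq₀ hIm hIp hs t (tzero μ hL)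
  rw [crossSite_tzero] at h2
  refine ⟨offset μ t h₀, Q * P * (hol U₀ y (Pi.single μ (L - 1)))⁻¹, rfl,
    (hQ.mul hP).mul (unitaryLike_hol hU₀ y _).inv, ?_⟩
  rw [corner_contour hL hTm]
  have e1 : ∀ Q P P₀ W : Rˣ, Q * P * P₀⁻¹ * (P₀ * W * P₀⁻¹) * (Q * P * P₀⁻¹)⁻¹ = Q * (P * W * P⁻¹) * Q⁻¹ :=
    fun Q P P₀ W => by group
  rw [e1]
  calc _ ≤ ‖((contourHol V L y μ (offset μ t h₀) * (contourHol U₀ L y μ (offset μ t h₀))⁻¹ : Rˣ) : R) -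
            ((Q * pert U₀ V (crossSite L y μ t) μ * Q⁻¹ : Rˣ) : R)‖
          + ‖((Q * pert U₀ V (crossSite L y μ t) μ * Q⁻¹ : Rˣ) : R) -
            ((Q * (P * pert U₀ V (site y (Pi.single μ (L - 1))) μ * P⁻¹) * Q⁻¹ : Rˣ) : R)‖ :=
        norm_sub_le_norm_sub_add_norm_sub _ _ _
    _ ≤ _ := by
        refine add_le_add h1 ?_
        simp only [Units.val_mul] at h2 ⊢
        exact (norm_conj_sub_conj_le hQ _ _).trans h2

/-- [folklore] The contour constant `ρ(d, L) = (d−1)(L−1)·(L + 2(d−1)(L−1))` for `I = (d−1)(L−1)(q_V + q₀)`: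
`(L−1)·I + (d−1)(L−1)(q_V + q₀ + 2I) = ρ(d,L)·(q_V + q₀)`. -/
def contourConst (d L : ℕ) : ℝ :=
  ((d : ℝ) - 1) * ((L : ℝ) - 1) * ((L : ℝ) + 2 * (((d : ℝ) - 1) * ((L : ℝ) - 1)))

/-- [cite: Balaban1985RegularSpaces, Lemma 1 proof pp. 79–80] **THE CONTOUR RATIOS, assembled**: for a unitary-like pair in
relative axial gauge on both blocks with curvature sups `q_V, q₀` on the plaquettes of `B(c₋) ∪ B(c₊)`, every contour ratio
`V(Γ_{c,x})U₀(Γ_{c,x})⁻¹`, `x ∈ B(c₋)`, is within `ρ(d,L)·(q_V + q₀)` of a unitary-like conjugate of `w_c = V(c)U₀(c)⁻¹`. [folklore] -/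
theorem contour_ratios [NormOneClass R] {U₀ V : Cfg d R} {L : ℕ} {y : Site d} {μ : Fin d} {qV q₀ : ℝ}
    (hU₀ : ∀ x ν, UnitaryLike (U₀ x ν)) (hV : ∀ x ν, UnitaryLike (V x ν)) (hL : 1 ≤ L)
    (hTm : TreeRel L y U₀ V) (hTp : TreeRel L (yplus L y μ) U₀ V)
    (hqV : PlaqSupPair L y μ (fun x ρ ν => ‖(plaq V x ρ ν : R) - 1‖) qV)
    (hq₀ : PlaqSupPair L y μ (fun x ρ ν => ‖(plaq U₀ x ρ ν : R) - 1‖) q₀) (hq : 0 ≤ qV + q₀)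
    {x : Site d} (hx : InBlock L y x) :
    ∃ (k : Fin d → ℕ) (Q : Rˣ), x = site y k ∧ UnitaryLike Q ∧
      ‖((contourHol V L y μ k * (contourHol U₀ L y μ k)⁻¹ : Rˣ) : R) -
          ((Q * (hol V y (Pi.single μ L) * (hol U₀ y (Pi.single μ L))⁻¹) * Q⁻¹ : Rˣ) : R)‖
        ≤ contourConst d L * (qV + q₀) := by
  have hd : 1 ≤ d := by have := μ.isLt; omega
  have hN := interiorConst_nonneg hd hL
  have hIm : ∀ x ν, InBlock L y x → InBlock L y (x + e ν) →
      ‖(pert U₀ V x ν : R) - 1‖ ≤ ((d : ℝ) - 1) * ((L : ℝ) - 1) * (qV + q₀) :=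
    interior_bound_of_treeRel hU₀ hV hTm (plaqSupPair_left hqV) (plaqSupPair_left hq₀) hq
  have hIp : ∀ x ν, InBlock L (yplus L y μ) x → InBlock L (yplus L y μ) (x + e ν) →
      ‖(pert U₀ V x ν : R) - 1‖ ≤ ((d : ℝ) - 1) * ((L : ℝ) - 1) * (qV + q₀) :=
    interior_bound_of_treeRel hU₀ hV hTp (plaqSupPair_right hqV) (plaqSupPair_right hq₀) hq
  have hs : 0 ≤ qV + q₀ + ((d : ℝ) - 1) * ((L : ℝ) - 1) * (qV + q₀) + ((d : ℝ) - 1) * ((L : ℝ) - 1) * (qV + q₀) := by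
    positivity
  obtain ⟨k, Q, hxk, hQ, h⟩ := contour_ratio_near_coarse hU₀ hV hL hTm hTp hqV hq₀ hIm hIp hs hx
  refine ⟨k, Q, hxk, hQ, h.trans (le_of_eq ?_)⟩
  unfold contourConst; ring

/-! ## §8  Non-vacuity -/

/-- [folklore] The hypotheses of `two_block_bound` are jointly satisfiable (flat pair over `ℝ`, any `d`, `L ≥ 1`, with
`q_V = q₀ = 0`): the theorem applies … -/
example (d L : ℕ) (hL : 1 ≤ L) (y : Site d) (μ : Fin d) (x : Site d) (ν : Fin d) (hx : InPair L y μ x)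
    (hxν : InPair L y μ (x + e ν)) :
    ‖(pert (fun _ _ => (1 : ℝˣ)) (fun _ _ => (1 : ℝˣ)) x ν : ℝ) - 1‖ ≤ crossConst d L * (0 + 0) +
      ‖(pert (fun _ _ => (1 : ℝˣ)) (fun _ _ => (1 : ℝˣ)) (site y (Pi.single μ (L - 1))) μ : ℝ) - 1‖ := by
  have hU : ∀ (x : Site d) (ν : Fin d), UnitaryLike ((fun _ _ => (1 : ℝˣ)) x ν) := fun _ _ => UnitaryLike.one
  have hT : ∀ z : Site d, TreeRel L z (fun _ _ => (1 : ℝˣ)) (fun _ _ => (1 : ℝˣ)) := fun _ _ _ _ _ _ => rfl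
  have hP : PlaqSupPair L y μ (fun x ρ ν => ‖(plaq (fun _ _ => (1 : ℝˣ)) x ρ ν : ℝ) - 1‖) 0 := by
    intro x ρ ν _ _ _ _ _; simp [plaq]
  exact two_block_bound hU hU hL (hT y) (hT _) hP hP (by norm_num) x ν hx hxν

/-- [folklore] … and its right-hand side then vanishes (`X_c = 0` for the flat pair): the conclusion forces `V′ = 1`. -/
example (d L : ℕ) (y : Site d) (μ : Fin d) : crossConst d L * (0 + 0) +
      ‖(pert (fun _ _ => (1 : ℝˣ)) (fun _ _ => (1 : ℝˣ)) (site y (Pi.single μ (L - 1))) μ : ℝ) - 1‖ = 0 := by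
  simp [pert]

end Literature.MathematicalPhysics.QuantumFieldTheory.Balaban1983to89.T4RelativeCombCrossing
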